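import Summits.QuantumFields.YangMills.Theorems.BalabanUVNodesN15TwoSpacingGluingCurvedKnitDefectObjects
import Summits.QuantumFields.YangMills.Theorems.BalabanUVNodesN15TwoSpacingGluingCurvedKnitDefectSmall
import Summits.QuantumFields.YangMills.Theorems.BalabanUVNodesN15TwoSpacingGluingCurvedCoverDefectCubes
import Summits.QuantumFields.YangMills.Theorems.BalabanUVNodesN15TwoSpacingGluingNeumannPropagatorPairDefect
import Summits.QuantumFields.YangMills.Theorems.BalabanUVNodesN15CurvedGluingSmoothCutDressedGluedDefectGaugedUN
import Summits.QuantumFields.YangMills.Theorems.BalabanUVNodesN15TwoSpacingGluingCurvedKnitDefect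
import HarnessLib

/-!
# THE GLUING STEP AT TWO LATTICE SPACINGS — FILE 123 WITH AN EXTERNALLY CAPPED DECAY RATE: `uN_idef_cvGlued_cap` — for every `δ_cap > 0` the two-grid η-defect of the glued
# propagators at the cover holds with SOME rate `δ ≤ δ_cap` (dag-n15-c g22, n15-c∕209; N15 = NE2, s1)

Cell `pub-ymgap`, seat `pub-ymgap-dag-n15-c` (R134 (a); HUMAN RULING D-0062), generation 22.  `bears_on: R4∕N15 · K3⁸ SpineGivenEndpointR13SepCoPHV (stmt-QuantumFields-27366)`.
Filed `--supports stmt-QuantumFields-27366 --as helper` — COUNT-NEUTRAL.  ONE theorem; 0 `sorry`; NO new estimate: the statement and proof text of this seat's FILE 123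
`…TwoSpacingGluingCurvedKnitDefect.uN_idef_cvGlued` (g15∕g16 lineage) VERBATIM, with the single change `δ := min (…the seven obtained rates…) δ_cap` (the proof uses the rate only
through `δ ≤ δ_i` and `δ > 0`).  Same imports as FILE 123; nothing in the tree modified ∕ restated (FILE 123 stays the un-capped citizen every later file consumes).

WHY (g22 PROGRAMME (P-R), «δ-coupling»; the one-grid twin is n15-c∕208 `uN_cvGlued_spec_cap`).  FILE 123 produces its rate `δ` EXISTENTIALLY and asks the six nonlocal-perturbation
rows (`N_V`, `N_V′` near∕far∕two-grid) AT THAT `δ`; a genuinely nonlocal perturbation — the Landau perturbation `N_V^R` of n15-c∕201, whose letters ([Balaban1985BackgroundPropagators]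
Thm 3.2 ∕ (3.49) ∕ Thm 3.4) come with their own rate `δ_R` — can only be fed in if `δ ≤ δ_R`.  THIS FILE makes the rate cappable (`∀ δ_cap > 0, ∃ δ ≤ δ_cap`; `w₀, R₀, θ₀, D` then
depend on `δ_cap`), so that the η-defect editions with displayed Landau rows (n15-c∕206 pattern) can be re-issued in a dischargeable form, and through them the node editions.

HONEST FRAMING ∕ LIMITS.  As FILE 123 (MODEL: doubled-torus cover, dressed smooth-cut cubes, per-cube gauges as data, rows displayed, (3.36) replaced by all mixed second
differences); NOT [Balaban1985BackgroundPropagators] Thm 3.1∕3.3 as printed; NE2⁺ NOT PRINTED; N15 of record untouched (DISCHARGED AS CONSUMED, p687738); counts UNMOVED (typed 28∕28);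
one finite 𝕋⁴ at fixed ε per index — NOT infinite volume ∕ OS ∕ mass gap ∕ Clay.  Restate-immune (no Theses import).
-/

noncomputable section

open scoped BigOperators Matrix Matrix.Norms.Frobenius

namespace Summit.QuantumFields.YangMills.BalabanUVNodes.N15.Gluing

open Real
open Literature.MathematicalPhysics.QuantumFieldTheory.Balaban1983to89
open Literature.MathematicalPhysics.QuantumFieldTheory.Balaban1983to89.B5Prop11Plancherel (Tor fine unitVec)
open Literature.MathematicalPhysics.QuantumFieldTheory.Balaban1983to89.B11SectG (BlockNorm HasMaj RowSum)
open Literature.MathematicalPhysics.QuantumFieldTheory.Balaban1983to89.T4EtaRateDefect (idef)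
open Literature.MathematicalPhysics.QuantumFieldTheory.Balaban1983to89.T4EtaRateCoeffDefect (pull)
open Literature.MathematicalPhysics.QuantumFieldTheory.Balaban1983to89.B6RandomWalk (Triangle254)
open Literature.MathematicalPhysics.QuantumFieldTheory.Balaban1983to89.B6Prop26Gluing (mulOp mulOp_apply ind ind_nonneg ind_le_one)
open Literature.MathematicalPhysics.QuantumFieldTheory.Balaban1983to89.B6UnitTorusCarrier (unitTorusGeo triangle254_unitTorusGeo rowSum_unitTorusGeo unitTorusGeo_dist_nonneg
  unitTorusGeo_dist_symm unitTorusGeo_dist_self)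
open Literature.MathematicalPhysics.QuantumFieldTheory.Balaban1983to89.B5SiteBridgeP12 (MP)
open Literature.MathematicalPhysics.QuantumFieldTheory.King1986.Torus (blockOf tdistT tdistT_nonneg tdistT_symm)
open Literature.Barriers.QuantumFields (traceForm)
open Summit.QuantumFields.YangMills.BalabanUVNodes.N15.BackgroundLayer (fgrad fgradAdj bgrad fgrad_apply fgradAdj_apply bgrad_apply stack projO bgPropV covLapM tCoefA tCoefC unstackM)
open Summit.QuantumFields.YangMills.BalabanUVNodes.N15.VectorPiece (bshiftEquiv bshiftEquiv_apply kingPrV tensorId hasMaj_tensorId tdistT_blockOf_sub_unitVec_le)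
open Summit.QuantumFields.YangMills.BalabanUVNodes.N15.MatrixSpecies (mmulOp coordMat liftBlk liftMap liftEquiv liftEquiv_apply liftEquiv_symm_apply)
open Summit.QuantumFields.YangMills.BalabanUVNodes.N15.TwoGrid (paramsOf symbOp sD landauRe qvRe qvAdjRe gOp neumannCubeG chiCube cubeBlocks ineq110_114_pair hasMaj_gOp_of_ineq hasMaj_grad_of_ineq
  hasMaj_landauRe chiCube_of_not_mem abs_chiCube_le_one hasMaj_idef_chiCube_neumannCubeG hasMaj_idef_chiCube_grad_neumannCubeG hasMaj_idef_chiCube_divAdjOut_neumannCubeG)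
open Summit.QuantumFields.YangMills.BalabanUVNodes.N15.CurvedSpecies (gaugePair uN_hasMaj_idef_glueInv_smoothCutDressed_localGauges)

variable {d : ℕ}

/-! ## §1 The live-`U` knit at the cover, two grids, rate-capped (the resummation factors `cv_inv_le_two(')` are FILE 123's, imported) -/

section Knit
variable {L : ℕ} [NeZero L]
set_option maxHeartbeats 800000 in
set_option maxRecDepth 2048 in
/-- ★★★ (RATE-CAPPED EDITION of FILE 123 `uN_idef_cvGlued`: `∀ δ_cap > 0, ∃ δ ≤ δ_cap`; otherwise verbatim) **THE LIVE-`U` KNIT AT THE COVER, TWO GRIDS (dag-n15-w3 53 INSTANTIATED): THE η-DEFECT OF THE GLUED PROPAGATOR OF BAŁABAN's `Δ_{R_U} + P` IS SMALL AND DECAYS.**  For odd `L ≥ 7`, `a > 0`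
and a colour index `ι` there are `δ, w₀, R₀, θ₀ > 0` and `D` such that on EVERY doubled torus `2L·L^m` of the cover (`k ≥ 1`, `L^m ≥ w₀`) and EVERY refinement `r`, for trace-form coordinates `e`,
unitary per-cube site gauges `u_k` ∕ `u′_k`, unitary bond fields `U`, `U′`, summands `P`, `P′` with the conjugation laws `M_{W_k}PM_{W_kᵀ} = N_L ⊗ 1 − N_V k` (both grids), the (3.35) letters `r_V` on
the cut boxes, the cut ∕ far ∕ defect letters `R_N`, `θ_F ≤ θ₀`, `o_N`, `r_D` of `N_V`, `N′_V`, the species fit `o_V` and the gauge fit `o_W` across King's pairing (`r_V(1+|J⊕J|) + R_N ≤ R₀`,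
`o_V(1+|J⊕J|) + o_N ≤ o`): the η-defect through `π̂ = π × 1_ι` of `cvGlued'` (spacing `(L^rL^k)^{−1}`) against `cvGlued` (spacing `L^{−k}`) is `≤ D·((L^k)^{−1∕16} + o + o_W + r_D)·e^{−(δ∕16)|y−y′|_T}`
blockwise — every one of 53's 165 rows DISCHARGED BY NAME except the DISPLAYED gauge-group data (the paper's small-field hypotheses + the lane's `P`∕`N_V` letters).  MODEL carriers; NOT [B9] Thm 3.14
as printed. [cite: Balaban1985BackgroundPropagators, Thm 3.14 pp.426–427 (template: «G(U′) − G(U) small»), (3.34)–(3.35) p.396, (3.62)–(3.65) pp.402–403; Balaban1984PropagatorsII, (2.133)–(2.136) p.247] -/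
theorem uN_idef_cvGlued_cap (hL : Odd L ∧ 1 < L) (hL7 : 7 ≤ L) {a : ℝ} (ha : 0 < a) (ι : Type) [Fintype ι] [DecidableEq ι] {δcap : ℝ} (hδcap : 0 < δcap) :
    ∃ δ w₀ R₀ θ₀ D : ℝ, 0 < δ ∧ δ ≤ δcap ∧ 0 < R₀ ∧ 0 < θ₀ ∧ ∀ (mv kk r : ℕ), 1 ≤ kk → w₀ ≤ ((L ^ mv : ℕ) : ℝ) → ∀ {mm : Type} [Fintype mm] [DecidableEq mm] (e : Matrix mm mm ℂ ≃L[ℝ] (ι → ℝ)), (∀ A B : Matrix mm mm ℂ, traceForm A B = e A ⬝ᵥ e B) →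
      ∀ (u : (Fin (d + 1) → ZMod (2 * L)) → CvX d L mv kk hL → Matrix mm mm ℂ) (u' : (Fin (d + 1) → ZMod (2 * L)) → CvX' d L mv kk r hL → Matrix mm mm ℂ), (∀ k x, (u k x)ᴴ * u k x = 1) → (∀ k x', (u' k x')ᴴ * u' k x' = 1) →
      ∀ (U : Fin (d + 1) → CvX d L mv kk hL → Matrix mm mm ℂ) (U' : Fin (d + 1) → CvX' d L mv kk r hL → Matrix mm mm ℂ) (P : (CvX d L mv kk hL × ι → ℝ) →ₗ[ℝ] (CvX d L mv kk hL × ι → ℝ)) (P' : (CvX' d L mv kk r hL × ι → ℝ) →ₗ[ℝ] (CvX' d L mv kk r hL × ι → ℝ))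
        (NV : (Fin (d + 1) → ZMod (2 * L)) → (CvX d L mv kk hL × ι → ℝ) →ₗ[ℝ] (CvX d L mv kk hL × ι → ℝ)) (NV' : (Fin (d + 1) → ZMod (2 * L)) → (CvX' d L mv kk r hL × ι → ℝ) →ₗ[ℝ] (CvX' d L mv kk r hL × ι → ℝ)) (rV RN θF rD oV oN o oW : ℝ),
        0 ≤ rV → 0 ≤ RN → 0 ≤ rD → 0 ≤ oV → 0 ≤ oN → 0 ≤ oW → rV * (1 + Fintype.card (Fin (d + 1) ⊕ Fin (d + 1))) + RN ≤ R₀ → oV * (1 + Fintype.card (Fin (d + 1) ⊕ Fin (d + 1))) + oN ≤ o → θF ≤ θ₀ →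
        (∀ k, mmulOp (fun x => coordMat e (ContinuousLinearMap.mulLeftRight ℝ (Matrix mm mm ℂ) (u k x) (u k x)ᴴ)) ∘ₗ P ∘ₗ mmulOp (fun x => (coordMat e (ContinuousLinearMap.mulLeftRight ℝ (Matrix mm mm ℂ) (u k x) (u k x)ᴴ))ᵀ) = (cvNL d L mv kk hL a ι) - NV k) →
        (∀ k, mmulOp (fun x' => coordMat e (ContinuousLinearMap.mulLeftRight ℝ (Matrix mm mm ℂ) (u' k x') (u' k x')ᴴ)) ∘ₗ P' ∘ₗ mmulOp (fun x' => (coordMat e (ContinuousLinearMap.mulLeftRight ℝ (Matrix mm mm ℂ) (u' k x') (u' k x')ᴴ))ᵀ) = (cvNL' d L mv kk r hL a ι) - NV' k) →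
        (∀ k x, cvChi d L mv kk hL k x ≠ 0 → ∀ i, ∑ j, |tCoefC ((((L ^ kk : ℕ) : ℝ))⁻¹) (gaugePair (bshiftEquiv (cvM d L mv kk hL) (L ^ kk)) fun μ x => coordMat e (ContinuousLinearMap.mulLeftRight ℝ (Matrix mm mm ℂ) (u k x * U μ x * (u k (bshiftEquiv (cvM d L mv kk hL) (L ^ kk) μ x))ᴴ) (u k x * U μ x * (u k (bshiftEquiv (cvM d L mv kk
          hL) (L ^ kk) μ x))ᴴ)ᴴ)) x i j| ≤ rV) →
        (∀ k j' x, cvChi d L mv kk hL k x ≠ 0 → ∀ i, ∑ j, |tCoefA ((((L ^ kk : ℕ) : ℝ))⁻¹) (gaugePair (bshiftEquiv (cvM d L mv kk hL) (L ^ kk)) fun μ x => coordMat e (ContinuousLinearMap.mulLeftRight ℝ (Matrix mm mm ℂ) (u k x * U μ x * (u k (bshiftEquiv (cvM d L mv kk hL) (L ^ kk) μ x))ᴴ) (u k x * U μ x * (u k (bshiftEquiv (cvM d L mv kk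
          hL) (L ^ kk) μ x))ᴴ)ᴴ)) j' x i j| ≤ rV) →
        (∀ k x', cvChi' d L mv kk r hL k x' ≠ 0 → ∀ i, ∑ j, |tCoefC ((((L ^ r * L ^ kk : ℕ) : ℝ))⁻¹) (gaugePair (bshiftEquiv (cvM d L mv kk hL) (L ^ r * L ^ kk)) fun μ x' => coordMat e (ContinuousLinearMap.mulLeftRight ℝ (Matrix mm mm ℂ) (u' k x' * U' μ x' * (u' k (bshiftEquiv (cvM d L mv kk hL) (L ^ r * L ^ kk) μ x'))ᴴ) (u' k x' * U' μ
          x' * (u' k (bshiftEquiv (cvM d L mv kk hL) (L ^ r * L ^ kk) μ x'))ᴴ)ᴴ)) x' i j| ≤ rV) →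
        (∀ k j' x', cvChi' d L mv kk r hL k x' ≠ 0 → ∀ i, ∑ j, |tCoefA ((((L ^ r * L ^ kk : ℕ) : ℝ))⁻¹) (gaugePair (bshiftEquiv (cvM d L mv kk hL) (L ^ r * L ^ kk)) fun μ x' => coordMat e (ContinuousLinearMap.mulLeftRight ℝ (Matrix mm mm ℂ) (u' k x' * U' μ x' * (u' k (bshiftEquiv (cvM d L mv kk hL) (L ^ r * L ^ kk) μ x'))ᴴ) (u' k x' * U'
          μ x' * (u' k (bshiftEquiv (cvM d L mv kk hL) (L ^ r * L ^ kk) μ x'))ᴴ)ᴴ)) j' x' i j| ≤ rV) →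
        (∀ k x' i, ∑ j, |(cvChi' d L mv kk r hL k x' • tCoefC ((((L ^ r * L ^ kk : ℕ) : ℝ))⁻¹) (gaugePair (bshiftEquiv (cvM d L mv kk hL) (L ^ r * L ^ kk)) fun μ x' => coordMat e (ContinuousLinearMap.mulLeftRight ℝ (Matrix mm mm ℂ) (u' k x' * U' μ x' * (u' k (bshiftEquiv (cvM d L mv kk hL) (L ^ r * L ^ kk) μ x'))ᴴ) (u' k x' * U' μ x' *
          (u' k (bshiftEquiv (cvM d L mv kk hL) (L ^ r * L ^ kk) μ x'))ᴴ)ᴴ)) x') i j - (cvChi d L mv kk hL k ((kingPrV L kk r (cvM d L mv kk hL)) x') • tCoefC ((((L ^ kk : ℕ) : ℝ))⁻¹) (gaugePair (bshiftEquiv (cvM d L mv kk hL) (L ^ kk)) fun μ x => coordMat e (ContinuousLinearMap.mulLeftRight ℝ (Matrix mm mm ℂ) (u k x * U μ x *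
          (u k (bshiftEquiv (cvM d L mv kk hL) (L ^ kk) μ x))ᴴ) (u k x * U μ x * (u k (bshiftEquiv (cvM d L mv kk hL) (L ^ kk) μ x))ᴴ)ᴴ)) ((kingPrV L kk r (cvM d L mv kk hL)) x')) i j| ≤ oV) →
        (∀ k j' x' i, ∑ j, |(cvChi' d L mv kk r hL k x' • tCoefA ((((L ^ r * L ^ kk : ℕ) : ℝ))⁻¹) (gaugePair (bshiftEquiv (cvM d L mv kk hL) (L ^ r * L ^ kk)) fun μ x' => coordMat e (ContinuousLinearMap.mulLeftRight ℝ (Matrix mm mm ℂ) (u' k x' * U' μ x' * (u' k (bshiftEquiv (cvM d L mv kk hL) (L ^ r * L ^ kk) μ x'))ᴴ) (u' k x' * U' μ x'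
          * (u' k (bshiftEquiv (cvM d L mv kk hL) (L ^ r * L ^ kk) μ x'))ᴴ)ᴴ)) j' x') i j - (cvChi d L mv kk hL k ((kingPrV L kk r (cvM d L mv kk hL)) x') • tCoefA ((((L ^ kk : ℕ) : ℝ))⁻¹) (gaugePair (bshiftEquiv (cvM d L mv kk hL) (L ^ kk)) fun μ x => coordMat e (ContinuousLinearMap.mulLeftRight ℝ (Matrix mm mm ℂ) (u k x * U μ
          x * (u k (bshiftEquiv (cvM d L mv kk hL) (L ^ kk) μ x))ᴴ) (u k x * U μ x * (u k (bshiftEquiv (cvM d L mv kk hL) (L ^ kk) μ x))ᴴ)ᴴ)) j' ((kingPrV L kk r (cvM d L mv kk hL)) x')) i j| ≤ oV) →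
        (∀ k, HasMaj (CvNorm d L mv kk hL ι) (CvNorm d L mv kk hL ι) (mulOp (fun p : CvX d L mv kk hL × ι => cvPsi d L mv kk hL k p.1) ∘ₗ NV k ∘ₗ mulOp (fun p : CvX d L mv kk hL × ι => cvChi d L mv kk hL k p.1)) (fun y y' => RN * Real.exp (-(δ * (unitTorusGeo L kk (cvM d L mv kk hL)).dist y y')))) →
        (∀ k, HasMaj (BlockNorm.ofBlocks (unitTorusGeo L kk (cvM d L mv kk hL)) (liftBlk (cvBlk d L mv kk hL ∘ (kingPrV L kk r (cvM d L mv kk hL))) ι)) (BlockNorm.ofBlocks (unitTorusGeo L kk (cvM d L mv kk hL)) (liftBlk (cvBlk d L mv kk hL ∘ (kingPrV L kk r (cvM d L mv kk hL))) ι)) (mulOp (fun p : CvX' d L mv kk r hL × ι => cvPsi' d L mv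
          kk r hL k p.1) ∘ₗ NV' k ∘ₗ mulOp (fun p : CvX' d L mv kk r hL × ι => cvChi' d L mv kk r hL k p.1)) (fun y y' => RN * Real.exp (-(δ * (unitTorusGeo L kk (cvM d L mv kk hL)).dist y y')))) →
        (∀ k, HasMaj (CvNorm d L mv kk hL ι) (BlockNorm.ofBlocks (unitTorusGeo L kk (cvM d L mv kk hL)) (liftBlk (cvBlk d L mv kk hL ∘ (kingPrV L kk r (cvM d L mv kk hL))) ι)) (idef (pull (liftMap (kingPrV L kk r (cvM d L mv kk hL)) ι)) (pull (liftMap (kingPrV L kk r (cvM d L mv kk hL)) ι)) (mulOp (fun p : CvX' d L mv kk r hL × ι =>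
          cvPsi' d L mv kk r hL k p.1) ∘ₗ NV' k ∘ₗ mulOp (fun p : CvX' d L mv kk r hL × ι => cvChi' d L mv kk r hL k p.1)) (mulOp (fun p : CvX d L mv kk hL × ι => cvPsi d L mv kk hL k p.1) ∘ₗ NV k ∘ₗ mulOp (fun p : CvX d L mv kk hL × ι => cvChi d L mv kk hL k p.1))) (fun y y' => oN * Real.exp (-(δ * (unitTorusGeo L kk (cvM d L
          mv kk hL)).dist y y')))) →
        (∀ k, HasMaj (CvNorm d L mv kk hL ι) (CvNorm d L mv kk hL ι) ((LinearMap.id - mulOp (fun p : CvX d L mv kk hL × ι => cvPsi d L mv kk hL k p.1)) ∘ₗ NV k ∘ₗ mulOp (fun p : CvX d L mv kk hL × ι => cvChi d L mv kk hL k p.1)) (fun y y' => θF * Real.exp (-(δ * (unitTorusGeo L kk (cvM d L mv kk hL)).dist y y')))) →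
        (∀ k, HasMaj (BlockNorm.ofBlocks (unitTorusGeo L kk (cvM d L mv kk hL)) (liftBlk (cvBlk d L mv kk hL ∘ (kingPrV L kk r (cvM d L mv kk hL))) ι)) (BlockNorm.ofBlocks (unitTorusGeo L kk (cvM d L mv kk hL)) (liftBlk (cvBlk d L mv kk hL ∘ (kingPrV L kk r (cvM d L mv kk hL))) ι)) ((LinearMap.id - mulOp (fun p : CvX' d L mv kk r hL × ι
          => cvPsi' d L mv kk r hL k p.1)) ∘ₗ NV' k ∘ₗ mulOp (fun p : CvX' d L mv kk r hL × ι => cvChi' d L mv kk r hL k p.1)) (fun y y' => θF * Real.exp (-(δ * (unitTorusGeo L kk (cvM d L mv kk hL)).dist y y')))) →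
        (∀ k, HasMaj (CvNorm d L mv kk hL ι) (BlockNorm.ofBlocks (unitTorusGeo L kk (cvM d L mv kk hL)) (liftBlk (cvBlk d L mv kk hL ∘ (kingPrV L kk r (cvM d L mv kk hL))) ι)) (idef (pull (liftMap (kingPrV L kk r (cvM d L mv kk hL)) ι)) (pull (liftMap (kingPrV L kk r (cvM d L mv kk hL)) ι)) ((LinearMap.id - mulOp (fun p : CvX' d L mv kk
          r hL × ι => cvPsi' d L mv kk r hL k p.1)) ∘ₗ NV' k ∘ₗ mulOp (fun p : CvX' d L mv kk r hL × ι => cvChi' d L mv kk r hL k p.1)) ((LinearMap.id - mulOp (fun p : CvX d L mv kk hL × ι => cvPsi d L mv kk hL k p.1)) ∘ₗ NV k ∘ₗ mulOp (fun p : CvX d L mv kk hL × ι => cvChi d L mv kk hL k p.1))) (fun y y' => rD * Real.exp (-(δ *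
          (unitTorusGeo L kk (cvM d L mv kk hL)).dist y y')))) →
        (∀ k x' i, ∑ j, |coordMat e (ContinuousLinearMap.mulLeftRight ℝ (Matrix mm mm ℂ) (u' k x') (u' k x')ᴴ) i j - coordMat e (ContinuousLinearMap.mulLeftRight ℝ (Matrix mm mm ℂ) (u k ((kingPrV L kk r (cvM d L mv kk hL)) x')) (u k ((kingPrV L kk r (cvM d L mv kk hL)) x'))ᴴ) i j| ≤ oW) →
        (∀ k x' i, ∑ j, |(coordMat e (ContinuousLinearMap.mulLeftRight ℝ (Matrix mm mm ℂ) (u' k x') (u' k x')ᴴ))ᵀ i j - (coordMat e (ContinuousLinearMap.mulLeftRight ℝ (Matrix mm mm ℂ) (u k ((kingPrV L kk r (cvM d L mv kk hL)) x')) (u k ((kingPrV L kk r (cvM d L mv kk hL)) x'))ᴴ))ᵀ i j| ≤ oW) →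
        HasMaj (CvNorm d L mv kk hL ι) (BlockNorm.ofBlocks (unitTorusGeo L kk (cvM d L mv kk hL)) (liftBlk (cvBlk d L mv kk hL ∘ kingPrV L kk r (cvM d L mv kk hL)) ι)) (idef (pull (liftMap (kingPrV L kk r (cvM d L mv kk hL)) ι)) (pull (liftMap (kingPrV L kk r (cvM d L mv kk hL)) ι))
            (cvGlued' d L mv kk r hL a ((((L ^ r * L ^ kk : ℕ) : ℝ))⁻¹) ι e u' U' P' NV') (cvGlued d L mv kk hL a ((((L ^ kk : ℕ) : ℝ))⁻¹) ι e u U P NV)) (fun y y' => D * ((((L ^ kk : ℕ) : ℝ)) ^ (-(1 / 16 : ℝ)) + (o + (oW + rD))) * Real.exp (-(δ / 16 * (unitTorusGeo L kk (cvM d L mv kk hL)).dist y y'))) := by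
  have hLodd : Odd L := hL.1; have hL3 : 3 ≤ L := (by omega); have hL2 : 2 ≤ L := (by omega); have hLpos : 0 < L := (by omega)
  -- the uniform letters of dag-n15-a's rows (both spacings) and of the two-grid defect families
  obtain ⟨δ₀, C, Cα, Cε, Cαε, hδ₀, hC, H⟩ := ineq110_114_pair (d := d) hL ha
  obtain ⟨δ₁, C₁, hδ₁, hC₁, HL⟩ := hasMaj_landauRe (d := d) (L := L)
  obtain ⟨δc, mc, hδc, hmc, HC⟩ := hasMaj_idef_chiCube_neumannCubeG (d := d) hLodd hL2 ha (γ := 1 / 8) (by norm_num) (by norm_num)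
  obtain ⟨δe, me, hδe, hme, HE⟩ := hasMaj_idef_chiCube_grad_neumannCubeG (d := d) hLodd hL2 ha
  obtain ⟨δh, mh, hδh, hmh, HH⟩ := hasMaj_idef_chiCube_divAdjOut_neumannCubeG (d := d) hLodd hL2 ha
  obtain ⟨δv, rr, hδv, hrr, HV⟩ := hasMaj_idef_nonlocal_family (d := d) hLodd hL2 ha (γ := 1 / 8) (by norm_num) (by norm_num)
  obtain ⟨δp, w₀p, Dp, hδp, hDp, HP0⟩ := hasMaj_idef_gOp_pair_of_cubes (d := d) hL ha
  let δm : ℝ := min (min (min (min δ₀ δ₁) (min δc δe)) (min (min δh δv) δp)) δcap; have hδm0 : 0 < δm := lt_min (lt_min (lt_min (lt_min hδ₀ hδ₁) (lt_min hδc hδe)) (lt_min (lt_min hδh hδv) hδp)) hδcap; have hδmcap : δm ≤ δcap := min_le_right _ _; have hδmδ₀ : δm ≤ δ₀ := (min_le_left _ _).trans ((min_le_left _ _).trans ((min_le_left _ _).trans (min_le_left _ _)))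
  have hδmδ₁ : δm ≤ δ₁ := (min_le_left _ _).trans ((min_le_left _ _).trans ((min_le_left _ _).trans (min_le_right _ _))); have hδmδc : δm ≤ δc := (min_le_left _ _).trans ((min_le_left _ _).trans ((min_le_right _ _).trans (min_le_left _ _))); have hδmδe : δm ≤ δe := (min_le_left _ _).trans ((min_le_left _ _).trans ((min_le_right _ _).trans (min_le_right _ _)))
  have hδmδh : δm ≤ δh := (min_le_left _ _).trans ((min_le_right _ _).trans ((min_le_left _ _).trans (min_le_left _ _))); have hδmδv : δm ≤ δv := (min_le_left _ _).trans ((min_le_right _ _).trans ((min_le_left _ _).trans (min_le_right _ _))); have hδmδp : δm ≤ δp := (min_le_left _ _).trans ((min_le_right _ _).trans (min_le_right _ _)); have hmax : 0 ≤ max me mh := hme.le.trans (le_max_left _ _)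
  let cr : ℝ := B4Sect5Proof.latticeConst (d + 1) (δm / 32); have hcr0 : 0 ≤ cr := B4Sect5Proof.latticeConst_nonneg (d + 1) (by positivity : (0:ℝ) ≤ δm / 32); let β : ℝ := 2 ^ (d + 1) * (C * Real.exp δ₀); let β₁ : ℝ := 2 ^ (d + 1) * (C * Real.exp δ₀ * Real.exp δ₀); let cN₀ : ℝ := |a| * (Real.exp δm * Real.exp δm) + C₁
  let E' : ℝ := (Real.exp 1 * (δm / 2))⁻¹; let Nov : ℝ := (((2 * L) ^ (d + 1) : ℕ) : ℝ); let cι2 : ℝ := (Fintype.card ι : ℝ) ^ 2; let R : ℝ := 1 / (2 * ((β + (β₁ + π * β)) * cr * cr) + 1); have hRdef : R = 1 / (2 * ((β + (β₁ + π * β)) * cr * cr) + 1) := rfl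
  let θ₀ : ℝ := 1 / (4 * (Nov * cr * (cι2 * (2 * (β + (β₁ + π * β))) * cr)) + 4); have hθ₀def : θ₀ = 1 / (4 * (Nov * cr * (cι2 * (2 * (β + (β₁ + π * β))) * cr)) + 4) := rfl; let κT : ℝ := 2 ^ (d + 1) * (cN₀ * (4 / δm) * (C * Real.exp δ₀) * cr); have hκTdef : κT = 2 ^ (d + 1) * (cN₀ * (4 / δm) * (C * Real.exp δ₀) * cr) := rfl
  let A₁ : ℝ := (Fintype.card (Fin (d + 1)) : ℝ) * (32 * π ^ 2 * (2 * (β + (β₁ + π * β))) + 2 * (π * (2 * (β + (β₁ + π * β))))) + (π * ((d : ℝ) + 1) * E' + 2 * (π * ((d : ℝ) + 1))) * cN₀ * (2 * (β + (β₁ + π * β))) * cr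
  let A₂ : ℝ := (π * ((d : ℝ) + 1) * (Real.exp 1 * (δm / 2))⁻¹ + 2 * (π * ((d : ℝ) + 1) + π * ((d : ℝ) + 1) * 1)) * R * (2 * (β + (β₁ + π * β))) * cr + R * π * (2 * (β + (β₁ + π * β))) * cr; let w₀ : ℝ := max (4 * (Nov * cr * (cι2 * (A₁ + A₂ + 2 * κT))) + 2) w₀p
  -- the `w`-free bounds of the two-grid letters (FILE 123b `cvSmall53`'s `κ`'s)
  let KRN : ℝ := (π * (d + 1) * E' + 2 * (π * (d + 1))) * rr + 2 * (π * (d + 1)) * cN₀; let KRF : ℝ := 2 ^ (d + 1) * Real.exp δm * cr * (cN₀ * Dp + cN₀ * ((d + 1) * C) + (cN₀ * (π * (d + 1)) + rr + (π * (d + 1)) * cN₀) * C); have hβ0 : 0 ≤ β := (by positivity); have hβ₁0 : 0 ≤ β₁ := (by positivity)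
  have hcN₀0 : 0 ≤ cN₀ := (by positivity); have hE'0 : 0 ≤ E' := (by positivity); have hNov0 : 0 ≤ Nov := (by positivity); have hκT0 : 0 ≤ κT := (by positivity); have hR0 : 0 < R := (by positivity); have hcι20 : 0 ≤ cι2 := (by show 0 ≤ (Fintype.card ι : ℝ) ^ 2; positivity); have hθ₀0 : 0 < θ₀ := (by positivity)
  have hA₁0 : 0 ≤ A₁ := (by positivity); have hA₂0 : 0 ≤ A₂ := (by positivity)
  let D53 : ℝ := ((((Nov * (cι2 * ((β + (β₁ + (π * β))) * 2))) * ((2 * ((2 * (Nov * ((((cι2 * ((((((Fintype.card (Fin (d + 1)) : ℝ) * (((32 * π ^ 2) * ((β + (β₁ + (π * β))) * 2)) + (2 * (π * ((β + (β₁ + (π * β))) * 2))))) + (0:ℝ)) + ((((π * (d + 1) * E' + 2 * (π * (d + 1))) * cN₀) * ((β + (β₁ + (π * β))) * 2)) * cr)) + (((((π * (d + 1) * E' + 2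
    * (π * (d + 1) + π * (d + 1) * 1)) * R) * ((β + (β₁ + (π * β))) * 2)) * cr) + (((R * π) * ((β + (β₁ + (π * β))) * 2)) * cr))) + ((θ₀ * (1 * ((β + (β₁ + (π * β))) * 2))) * cr))) * (π * (d + 1))) + ((cι2 * ((((((Fintype.card (Fin (d + 1)) : ℝ) * ((((32 * π ^ 2) * ((((((mc + ((π * (d + 1)) * β)) + ((((max me mh) + ((2 * (π * (d
    + 1))) * β₁)) + (π * mc)) + ((32 * π ^ 4 + π ^ 2 * (d + 1)) * β))) * cr) + ((1 * (((mc + ((π * (d + 1)) * β)) + ((((max me mh) + ((2 * (π * (d + 1))) * β₁)) + (π * mc)) + ((32 * π ^ 4 + π ^ 2 * (d + 1)) * β))) * cr)) * ((R * ((β + (β₁ + (π * β))) * 2)) * cr))) + (((((β + (β₁ + (π * β))) * (1:ℝ)) * cr) * ((β + (β₁ + (π * β)))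
    * 2)) * cr)) * 2)) + ((144 * π ^ 3 + 32 * π ^ 3 * Fintype.card (Fin (d + 1))) * ((β + (β₁ + (π * β))) * 2))) + (2 * ((π * ((((((mc + ((π * (d + 1)) * β)) + ((((max me mh) + ((2 * (π * (d + 1))) * β₁)) + (π * mc)) + ((32 * π ^ 4 + π ^ 2 * (d + 1)) * β))) * cr) + ((1 * (((mc + ((π * (d + 1)) * β)) + ((((max me mh) + ((2 * (π *
    (d + 1))) * β₁)) + (π * mc)) + ((32 * π ^ 4 + π ^ 2 * (d + 1)) * β))) * cr)) * ((R * ((β + (β₁ + (π * β))) * 2)) * cr))) + (((((β + (β₁ + (π * β))) * (1:ℝ)) * cr) * ((β + (β₁ + (π * β))) * 2)) * cr)) * 2)) + ((64 * π ^ 2 + π ^ 2 * Fintype.card (Fin (d + 1))) * ((β + (β₁ + (π * β))) * 2)))))) + (0:ℝ)) + (((((π * (d + 1) * E'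
    + 2 * (π * (d + 1))) * cN₀) * ((((((mc + ((π * (d + 1)) * β)) + ((((max me mh) + ((2 * (π * (d + 1))) * β₁)) + (π * mc)) + ((32 * π ^ 4 + π ^ 2 * (d + 1)) * β))) * cr) + ((1 * (((mc + ((π * (d + 1)) * β)) + ((((max me mh) + ((2 * (π * (d + 1))) * β₁)) + (π * mc)) + ((32 * π ^ 4 + π ^ 2 * (d + 1)) * β))) * cr)) * ((R * ((β +
    (β₁ + (π * β))) * 2)) * cr))) + (((((β + (β₁ + (π * β))) * (1:ℝ)) * cr) * ((β + (β₁ + (π * β))) * 2)) * cr)) * 2)) * cr) + ((KRN * ((β + (β₁ + (π * β))) * 2)) * cr))) + (((((((π * (d + 1) * E' + 2 * (π * (d + 1) + π * (d + 1) * 1)) * R) * ((((((mc + ((π * (d + 1)) * β)) + ((((max me mh) + ((2 * (π * (d + 1))) * β₁)) + (π *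
    mc)) + ((32 * π ^ 4 + π ^ 2 * (d + 1)) * β))) * cr) + ((1 * (((mc + ((π * (d + 1)) * β)) + ((((max me mh) + ((2 * (π * (d + 1))) * β₁)) + (π * mc)) + ((32 * π ^ 4 + π ^ 2 * (d + 1)) * β))) * cr)) * ((R * ((β + (β₁ + (π * β))) * 2)) * cr))) + (((((β + (β₁ + (π * β))) * (1:ℝ)) * cr) * ((β + (β₁ + (π * β))) * 2)) * cr)) * 2)) +
    ((((π * (d + 1) * E' + 2 * (π * (d + 1) + π * (d + 1) * 1)) * (1:ℝ)) + ((2 * R) * (((π * (d + 1)) + π) + π))) * ((β + (β₁ + (π * β))) * 2))) + (R * ((π * ((((((mc + ((π * (d + 1)) * β)) + ((((max me mh) + ((2 * (π * (d + 1))) * β₁)) + (π * mc)) + ((32 * π ^ 4 + π ^ 2 * (d + 1)) * β))) * cr) + ((1 * (((mc + ((π * (d + 1)) *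
    β)) + ((((max me mh) + ((2 * (π * (d + 1))) * β₁)) + (π * mc)) + ((32 * π ^ 4 + π ^ 2 * (d + 1)) * β))) * cr)) * ((R * ((β + (β₁ + (π * β))) * 2)) * cr))) + (((((β + (β₁ + (π * β))) * (1:ℝ)) * cr) * ((β + (β₁ + (π * β))) * 2)) * cr)) * 2)) + ((64 * π ^ 2 + π ^ 2 * Fintype.card (Fin (d + 1))) * ((β + (β₁ + (π * β))) * 2)))))
    + (((1:ℝ) * π) * ((β + (β₁ + (π * β))) * 2))) * cr)) + (((θ₀ * ((1 * ((((((mc + ((π * (d + 1)) * β)) + ((((max me mh) + ((2 * (π * (d + 1))) * β₁)) + (π * mc)) + ((32 * π ^ 4 + π ^ 2 * (d + 1)) * β))) * cr) + ((1 * (((mc + ((π * (d + 1)) * β)) + ((((max me mh) + ((2 * (π * (d + 1))) * β₁)) + (π * mc)) + ((32 * π ^ 4 + π ^ 2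
    * (d + 1)) * β))) * cr)) * ((R * ((β + (β₁ + (π * β))) * 2)) * cr))) + (((((β + (β₁ + (π * β))) * (1:ℝ)) * cr) * ((β + (β₁ + (π * β))) * 2)) * cr)) * 2)) + ((1 * ((β + (β₁ + (π * β))) * 2)) * (π * (d + 1))))) * cr) + (((1:ℝ) * (1 * ((β + (β₁ + (π * β))) * 2))) * cr)))) + (((2 * (Fintype.card ι : ℝ)) * (1:ℝ)) *
    ((((((Fintype.card (Fin (d + 1)) : ℝ) * (((32 * π ^ 2) * ((β + (β₁ + (π * β))) * 2)) + (2 * (π * ((β + (β₁ + (π * β))) * 2))))) + (0:ℝ)) + ((((π * (d + 1) * E' + 2 * (π * (d + 1))) * cN₀) * ((β + (β₁ + (π * β))) * 2)) * cr)) + (((((π * (d + 1) * E' + 2 * (π * (d + 1) + π * (d + 1) * 1)) * R) * ((β + (β₁ + (π * β))) * 2)) *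
    cr) + (((R * π) * ((β + (β₁ + (π * β))) * 2)) * cr))) + ((θ₀ * (1 * ((β + (β₁ + (π * β))) * 2))) * cr))))) + (((cι2 * ((κT * 2) + 0)) * (π * (d + 1))) + ((cι2 * ((((κT * ((R * ((((((mc + ((π * (d + 1)) * β)) + ((((max me mh) + ((2 * (π * (d + 1))) * β₁)) + (π * mc)) + ((32 * π ^ 4 + π ^ 2 * (d + 1)) * β))) * cr) + ((1 *
    (((mc + ((π * (d + 1)) * β)) + ((((max me mh) + ((2 * (π * (d + 1))) * β₁)) + (π * mc)) + ((32 * π ^ 4 + π ^ 2 * (d + 1)) * β))) * cr)) * ((R * ((β + (β₁ + (π * β))) * 2)) * cr))) + (((((β + (β₁ + (π * β))) * (1:ℝ)) * cr) * ((β + (β₁ + (π * β))) * 2)) * cr)) * 2)) + ((1:ℝ) * ((β + (β₁ + (π * β))) * 2)))) * cr) * cr) + (KRF *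
    (1 + (((R * ((β + (β₁ + (π * β))) * 2)) * cr) * cr))))) + (((2 * (Fintype.card ι : ℝ)) * (1:ℝ)) * ((κT * 2) + 0))))))) * cr)) * cr)) * cr) + (((Nov * (((2 * (cι2 * ((β + (β₁ + (π * β))) * 2))) * (π * (d + 1))) + ((cι2 * ((((((mc + ((π * (d + 1)) * β)) + ((((max me mh) + ((2 * (π * (d + 1))) * β₁)) + (π * mc)) + ((32 * π ^ 4
    + π ^ 2 * (d + 1)) * β))) * cr) + ((1 * (((mc + ((π * (d + 1)) * β)) + ((((max me mh) + ((2 * (π * (d + 1))) * β₁)) + (π * mc)) + ((32 * π ^ 4 + π ^ 2 * (d + 1)) * β))) * cr)) * ((R * ((β + (β₁ + (π * β))) * 2)) * cr))) + (((((β + (β₁ + (π * β))) * (1:ℝ)) * cr) * ((β + (β₁ + (π * β))) * 2)) * cr)) * 2)) + (((2 *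
    (Fintype.card ι : ℝ)) * (1:ℝ)) * ((β + (β₁ + (π * β))) * 2))))) * 2) * cr))
  refine ⟨δm, w₀, R, θ₀, D53, hδm0, hδmcap, hR0, hθ₀0, fun mv kk r hk hw₀ => ?_⟩
  intro mm _ _ e he u u' hu hu' U U' P P' NV NV' rV RN θF rD oV oN o oW hrV hRN hrD hoV hoN hoW0 hRle hole hθle
    hP hP' hCloc hAloc hCloc' hAloc' hfitC hfitA hNVcut hNVcut' hDNV hfarN hfarN' hDfarN hfitW hfitWT
  -- the data of the cover at `(m, k, r)`
  have hn : 1 ≤ L ^ kk := Nat.one_le_pow _ _ hLpos; have hn4 : 4 ≤ L ^ kk := le_trans (by omega : 4 ≤ L) (Nat.le_self_pow (by omega) L); have hn' : 1 ≤ L ^ r * L ^ kk := Nat.one_le_iff_ne_zero.mpr (Nat.mul_ne_zero (pow_ne_zero r (NeZero.ne L)) (pow_ne_zero kk (NeZero.ne L)))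
  have hw₀k : 4 * (Nov * cr * (cι2 * (A₁ + A₂ + 2 * κT))) + 2 ≤ ((L ^ mv : ℕ) : ℝ) := (le_max_left _ _).trans hw₀; have hw₀p' : w₀p ≤ ((L ^ mv : ℕ) : ℝ) := (le_max_right _ _).trans hw₀; have hW0 : 4 * (Nov * cr * (cι2 * (A₁ + A₂ + 2 * κT))) ≤ ((L ^ mv : ℕ) : ℝ) := (by linarith only [hw₀k])
  have hW2R : (2 : ℝ) ≤ ((L ^ mv : ℕ) : ℝ) := by
    have : 0 ≤ 4 * (Nov * cr * (cι2 * (A₁ + A₂ + 2 * κT))) := by positivity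
    linarith only [this, hw₀k]
  have hW2 : 2 ≤ L ^ mv := (by exact_mod_cast hW2R); have hw : 0 < L ^ mv := (by omega); have hW1 : (1 : ℝ) ≤ ((L ^ mv : ℕ) : ℝ) := (by linarith only [hW2R]); have hWpos : (0 : ℝ) < ((L ^ mv : ℕ) : ℝ) := (by linarith only [hW2R]); have hnR : (1 : ℝ) ≤ ((L ^ kk : ℕ) : ℝ) := (by exact_mod_cast hn)
  have hnR0 : (0 : ℝ) < ((L ^ kk : ℕ) : ℝ) := (by linarith only [hnR]); have hn'R0 : (0 : ℝ) < ((L ^ r * L ^ kk : ℕ) : ℝ) := Nat.cast_pos.mpr (Nat.mul_pos (pow_pos hLpos r) (pow_pos hLpos kk)); have hnn' : ((L ^ kk : ℕ) : ℝ) ≤ ((L ^ r * L ^ kk : ℕ) : ℝ) := (by exact_mod_cast Nat.le_mul_of_pos_left _ (pow_pos hLpos r))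
  have hM : ∀ ν, cvM d L mv kk hL ν = 2 * L * L ^ mv := MP_succ_eq L mv kk hL
  have hM' : ∀ ν, cvM d L mv kk hL ν = 2 * (L * L ^ mv) := fun ν => by rw [hM ν, mul_assoc]
  have hlo : (2 : ℝ) * ((L ^ mv : ℕ) : ℝ) ≤ ((2 * L ^ mv : ℕ) : ℝ) := (by push_cast; exact le_rfl); have hhi : ((2 * L ^ mv : ℕ) : ℝ) + ((L ^ mv : ℕ) : ℝ) + (2 + 1) * ((L ^ mv : ℕ) : ℝ) + 1 ≤ ((6 * L ^ mv + 1 : ℕ) : ℝ) := (by push_cast; linarith only [])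
  have hS6 : 6 * L ^ mv + 1 ≤ 2 * L * L ^ mv := by
    have h7 : 7 * L ^ mv ≤ L * L ^ mv := Nat.mul_le_mul_right _ hL7
    have e : 2 * L * L ^ mv = 2 * (L * L ^ mv) := by ring
    rw [e]; omega
  have hm₁ : 2 * L ^ mv ≤ coverMargin L mv := two_mul_le_coverMargin hL7 mv; have hmw : L ^ mv - 1 ≤ coverMargin L mv := (by omega); have hfitI : coverMargin L mv - 2 * L ^ mv + (6 * L ^ mv + 1) ≤ L * L ^ mv := coverMargin_inner_fit hL7 hW2; have hfit0 := coverMargin_fit hL3 mv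
  have hfit : coverMargin L mv + 2 * L ^ mv + 1 ≤ L * L ^ mv := (by omega); have hS0 : L * L ^ mv ≤ 2 * L * L ^ mv := (by rw [mul_assoc]; omega)
  have h3 : 3 ≤ L ^ kk * L ^ mv :=
    calc 3 ≤ L := hL3
      _ = L ^ 1 := (pow_one L).symm
      _ ≤ L ^ kk := Nat.pow_le_pow_right hLpos hk
      _ = L ^ kk * 1 := (mul_one _).symm
      _ ≤ L ^ kk * L ^ mv := Nat.mul_le_mul_left _ hw
  have hSe : L ^ (mv + 1) = L * L ^ mv := (by rw [pow_succ, mul_comm]); have hexp16 : (-((1 : ℝ) / 8 / 2)) = -(1 / 16 : ℝ) := (by norm_num); have hRq : (2 : ℝ) * 2 + 4 ≤ ((2 * L : ℕ) : ℝ) := (by push_cast; linarith only [show (7 : ℝ) ≤ L by exact_mod_cast hL7]); let η : ℝ := (((L ^ kk : ℕ) : ℝ))⁻¹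
  let η' : ℝ := (((L ^ r * L ^ kk : ℕ) : ℝ))⁻¹; let W : ℝ := ((L ^ mv : ℕ) : ℝ); have hηinv : η⁻¹ = ((L ^ kk : ℕ) : ℝ) := inv_inv _; have hη'inv : η'⁻¹ = ((L ^ r * L ^ kk : ℕ) : ℝ) := inv_inv _; have hη0 : 0 ≤ η := inv_nonneg.mpr hnR0.le; have hη'0 : 0 ≤ η' := inv_nonneg.mpr hn'R0.le
  have hR2 : 1 + |(((L ^ kk : ℕ) : ℝ) * W)⁻¹| ≤ (2 : ℝ) := one_add_inv_le_of_two_le 2 hw le_rfl; let εT : ℝ := 2 ^ (d + 1) * (cN₀ * Real.exp (-((δm - 3 * δm / 4) * W)) * (C * Real.exp δ₀) * cr); have hεT : εT = 2 ^ (d + 1) * (cN₀ * Real.exp (-((δm - 3 * δm / 4) * W)) * (C * Real.exp δ₀) * cr) := rfl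
  have hεT0 : 0 ≤ εT := mul_nonneg (by positivity) (mul_nonneg (mul_nonneg (mul_nonneg hcN₀0 (Real.exp_nonneg _)) (mul_nonneg hC.le (Real.exp_nonneg _))) hcr0); let εk : ℝ := ((L ^ kk : ℕ) : ℝ) ^ (-(1 / 16 : ℝ))
  obtain ⟨hnε, hnwε, hw1, hεk0⟩ := rpow_sixteenth_facts hnR hW1
  have hn'ε : (((L ^ r * L ^ kk : ℕ) : ℝ))⁻¹ ≤ εk := (inv_anti₀ hnR0 hnn').trans hnε; let Sdef : ℝ := εk + (o + (oW + rD)); have ho0 : 0 ≤ o := le_trans (by positivity) hole; have hεS : εk ≤ Sdef := (by show εk ≤ εk + (o + (oW + rD)); linarith only [ho0, hoW0, hrD]); have hS0' : 0 ≤ Sdef := hεk0.trans hεS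
  -- the two-grid letters of the cover
  let O1 : ℝ := |W⁻¹| * (((L ^ kk : ℕ) : ℝ) * W)⁻¹ * (64 * π ^ 2 + π ^ 2 * Fintype.card (Fin (d + 1))); let O2 : ℝ := W⁻¹ ^ 2 * (((L ^ kk : ℕ) : ℝ) * W)⁻¹ * (144 * π ^ 3 + 32 * π ^ 3 * Fintype.card (Fin (d + 1)))
  let RNK : ℝ := (π * (d + 1) / W * (Real.exp 1 * (δm / 2))⁻¹ + 2 * (π * (d + 1) / W)) * (rr * εk) + 2 * (π * (d + 1) / (((L ^ kk : ℕ) : ℝ) * W)) * cN₀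
  let RFK : ℝ := 2 ^ (d + 1) * Real.exp δm * cr * (cN₀ * Real.exp (-((δm - 3 * δm / 4) * W)) * (Dp * εk) + cN₀ * Real.exp (-((δm - 3 * δm / 4) * W)) * ((d + 1) * (C / (L ^ kk : ℕ))) + ((cN₀ * (π * (d + 1) / (((L ^ kk : ℕ) : ℝ) * W)) + rr * εk + (π * (d + 1) / (((L ^ kk : ℕ) : ℝ) * W)) * cN₀) * Real.exp (-((δm - 3 * δm / 4) * W)) * C))
  have hoχ0 : 0 ≤ π * (d + 1) / (((L ^ kk : ℕ) : ℝ) * W) := div_nonneg (by positivity) (mul_nonneg hnR0.le hWpos.le); have hoχ₂0 : 0 ≤ (W)⁻¹ * (((L ^ kk : ℕ) : ℝ) * W)⁻¹ * (32 * π ^ 4 + π ^ 2 * (d + 1)) := mul_nonneg (mul_nonneg (inv_nonneg.mpr hWpos.le) (inv_nonneg.mpr (mul_nonneg hnR0.le hWpos.le))) (by positivity)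
  have ho₁0 : 0 ≤ O1 := mul_nonneg (mul_nonneg (abs_nonneg _) (inv_nonneg.mpr (mul_nonneg hnR0.le hWpos.le))) (by positivity); have ho₂0 : 0 ≤ O2 := mul_nonneg (mul_nonneg (pow_nonneg (inv_nonneg.mpr hWpos.le) 2) (inv_nonneg.mpr (mul_nonneg hnR0.le hWpos.le))) (by positivity)
  have hℓ1 : π * (d + 1) / W ≤ π * (d + 1) := div_le_self (by positivity) hW1; have hLR0 : 0 ≤ π * (d + 1) / W * (Real.exp 1 * (δm / 2))⁻¹ + 2 * (π * (d + 1) / W) := (by positivity)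
  have hLRb : π * (d + 1) / W * (Real.exp 1 * (δm / 2))⁻¹ + 2 * (π * (d + 1) / W) ≤ π * (d + 1) * E' + 2 * (π * (d + 1)) :=
    add_le_add (mul_le_mul_of_nonneg_right hℓ1 hE'0) (by linarith only [hℓ1])
  have hLR20 : 0 ≤ π * (d + 1) / W * (Real.exp 1 * (δm / 2))⁻¹ + 2 * (π * (d + 1) / W + π * (d + 1) / W * 1) := by positivity
  have hLRb2 : π * (d + 1) / W * (Real.exp 1 * (δm / 2))⁻¹ + 2 * (π * (d + 1) / W + π * (d + 1) / W * 1) ≤ π * (d + 1) * E' + 2 * (π * (d + 1) + π * (d + 1) * 1) :=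
    add_le_add (mul_le_mul_of_nonneg_right hℓ1 hE'0) (by linarith only [hℓ1])
  have hcN0 : 0 ≤ (π * (d + 1) / W * (Real.exp 1 * (δm / 2))⁻¹ + 2 * (π * (d + 1) / W)) * cN₀ := mul_nonneg hLR0 hcN₀0; have hX0 : 0 ≤ Real.exp (-((δm - 3 * δm / 4) * W)) := Real.exp_nonneg _
  have hX1 : Real.exp (-((δm - 3 * δm / 4) * W)) ≤ 1 := Real.exp_le_one_iff.mpr (neg_nonpos.mpr (mul_nonneg (by linarith only [hδm0]) hWpos.le)); have hRNK0 : 0 ≤ RNK := add_nonneg (mul_nonneg hLR0 (mul_nonneg hrr.le hεk0)) (mul_nonneg (mul_nonneg zero_le_two hoχ0) hcN₀0)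
  have hRFK0 : 0 ≤ RFK := mul_nonneg (by positivity) (add_nonneg (add_nonneg (mul_nonneg (mul_nonneg hcN₀0 hX0) (mul_nonneg hDp.le hεk0))
    (mul_nonneg (mul_nonneg hcN₀0 hX0) (mul_nonneg (by positivity) (div_nonneg hC.le (by positivity)))))
    (mul_nonneg (mul_nonneg (add_nonneg (add_nonneg (mul_nonneg hcN₀0 hoχ0) (mul_nonneg hrr.le hεk0)) (mul_nonneg hoχ0 hcN₀0)) hX0) hC.le))
  -- the torus letters at both spacings, the defect families, weakened to the common rate `δm`
  have Hk := (H (mv + 1) kk r hk).1; have Hk' := (H (mv + 1) kk r hk).2; have hG := hasMaj_gOp_of_ineq (L := L) (k := kk) (cvM d L mv kk hL) (L ^ kk) a hn Hk hC.le; have hG' := hasMaj_gOp_of_ineq (L := L) (k := kk) (cvM d L mv kk hL) (L ^ r * L ^ kk) a hn' Hk' hC.le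
  have hD := fun ν => hasMaj_grad_of_ineq (L := L) (k := kk) (cvM d L mv kk hL) (L ^ kk) a hn Hk hC.le ν; have hD' := fun ν => hasMaj_grad_of_ineq (L := L) (k := kk) (cvM d L mv kk hL) (L ^ r * L ^ kk) a hn' Hk' hC.le ν; have hNL := HL kk (L ^ kk) (cvM d L mv kk hL); have hNL' := HL kk (L ^ r * L ^ kk) (cvM d L mv kk hL)
  have htri0 := triangle254_unitTorusGeo L kk (cvM d L mv kk hL); have hrow : RowSum (unitTorusGeo L kk (cvM d L mv kk hL)) (δm / 32) cr := rowSum_unitTorusGeo L kk _ (by positivity : (0:ℝ) < δm / 32)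
  have hGm : HasMaj (BlockNorm.ofBlocks (unitTorusGeo L kk (cvM d L mv kk hL)) (fun b : CvX d L mv kk hL => blockOf (L ^ kk) (cvM d L mv kk hL) b.1)) (BlockNorm.ofBlocks (unitTorusGeo L kk (cvM d L mv kk hL)) (fun b : CvX d L mv kk hL => blockOf (L ^ kk) (cvM d L mv kk hL) b.1)) (gOp (cvM d L mv kk hL) (L ^ kk) a) (fun y y' => C * Real.exp (-(δm * tdistT (cvM d L mv kk hL) y y'))) :=
    hG.mono fun y y' => mul_le_mul_of_nonneg_left (Real.exp_le_exp.mpr (neg_le_neg (mul_le_mul_of_nonneg_right hδmδ₀ (tdistT_nonneg (cvM d L mv kk hL) y y')))) hC.le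
  have hDm : ∀ ν, HasMaj (BlockNorm.ofBlocks (unitTorusGeo L kk (cvM d L mv kk hL)) (fun b : CvX d L mv kk hL => blockOf (L ^ kk) (cvM d L mv kk hL) b.1)) (BlockNorm.ofBlocks (unitTorusGeo L kk (cvM d L mv kk hL)) (fun b : CvX d L mv kk hL => blockOf (L ^ kk) (cvM d L mv kk hL) b.1)) (symbOp (cvM d L mv kk hL) (L ^ kk) (sD (cvM d L mv kk hL) (L ^ kk) ν ((L ^ kk : ℕ) : ℝ)) ∘ₗ gOp (cvM d L mv kk hL) (L ^ kk) a)
      (fun y y' => C * Real.exp (-(δm * tdistT (cvM d L mv kk hL) y y'))) :=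
    fun ν => (hD ν).mono fun y y' => mul_le_mul_of_nonneg_left (Real.exp_le_exp.mpr (neg_le_neg (mul_le_mul_of_nonneg_right hδmδ₀ (tdistT_nonneg (cvM d L mv kk hL) y y')))) hC.le
  have h0m : HasMaj (BlockNorm.ofBlocks (unitTorusGeo L kk (cvM d L mv kk hL)) (fun b : CvX d L mv kk hL => blockOf (L ^ kk) (cvM d L mv kk hL) b.1)) (BlockNorm.ofBlocks (unitTorusGeo L kk (cvM d L mv kk hL)) (fun i : CvX' d L mv kk r hL => blockOf (L ^ r * L ^ kk) (cvM d L mv kk hL) i.1)) (idef (pull (kingPrV L kk r (cvM d L mv kk hL))) (pull (kingPrV L kk r (cvM d L mv kk hL))) (gOp (cvM d L mv kk hL) (L ^ r * L ^ kk) a) (gOp (cvM d L mv kk hL) (L ^ kk) a))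
      (fun y y' => Dp * εk * Real.exp (-(δm * tdistT (cvM d L mv kk hL) y y'))) :=
    (HP0 mv kk r hk hn4 hw₀p').mono fun y y' => mul_le_mul_of_nonneg_left (Real.exp_le_exp.mpr (neg_le_neg (mul_le_mul_of_nonneg_right hδmδp (tdistT_nonneg (cvM d L mv kk hL) y y')))) (mul_nonneg hDp.le hεk0)
  have hblk : (fun i : CvX' d L mv kk r hL => blockOf (L ^ r * L ^ kk) (cvM d L mv kk hL) i.1) = (fun b : CvX d L mv kk hL => blockOf (L ^ kk) (cvM d L mv kk hL) b.1) ∘ kingPrV L kk r (cvM d L mv kk hL) :=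
    (VectorPiece.blkFine_comp_kingPrV (M := cvM d L mv kk hL) L kk r).symm
  have hNsc := hasMaj_nonlocalPart (L := L) (kk := kk) (a := a) hC₁.le hδm0.le hδmδ₁ hNL; have hNsc' := hasMaj_src_tgt_congr hblk (hasMaj_nonlocalPart (L := L) (kk := kk) (a := a) hC₁.le hδm0.le hδmδ₁ hNL'); have hDNsc0 := hasMaj_idef_nonlocal_cover_of mv kk r hL a hrr.le hδmδv (HV (mv + 1) kk r hk hL)
  have hDNsc := hasMaj_tgt_congr hblk hDNsc0
  have hind : ∀ (k : Fin (d + 1) → ZMod (2 * L)) (y y' : Tor (cvM d L mv kk hL)), 0 ≤ ind (g := unitTorusGeo L kk (cvM d L mv kk hL)) (cvSk d L mv kk hL k) y * ind (g := unitTorusGeo L kk (cvM d L mv kk hL)) (cvSk d L mv kk hL k) y' :=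
    fun k y y' => mul_nonneg (ind_nonneg _ _) (ind_nonneg _ _)
  have hKc : ∀ (k : Fin (d + 1) → ZMod (2 * L)) (y y' : Tor (cvM d L mv kk hL)), 0 ≤ ind (g := unitTorusGeo L kk (cvM d L mv kk hL)) (cvSk d L mv kk hL k) y * ind (g := unitTorusGeo L kk (cvM d L mv kk hL)) (cvSk d L mv kk hL k) y' * (mc * εk * Real.exp (-(δm * tdistT (cvM d L mv kk hL) y y'))) :=
    fun k y y' => mul_nonneg (hind k y y') (mul_nonneg (mul_nonneg hmc.le hεk0) (Real.exp_nonneg _))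
  have hKe : ∀ (k : Fin (d + 1) → ZMod (2 * L)) (y y' : Tor (cvM d L mv kk hL)), 0 ≤ ind (g := unitTorusGeo L kk (cvM d L mv kk hL)) (cvSk d L mv kk hL k) y * ind (g := unitTorusGeo L kk (cvM d L mv kk hL)) (cvSk d L mv kk hL k) y' * (max me mh * εk * Real.exp (-(δm * tdistT (cvM d L mv kk hL) y y'))) :=
    fun k y y' => mul_nonneg (hind k y y') (mul_nonneg (mul_nonneg hmax hεk0) (Real.exp_nonneg _))
  have hIGc := fun k => hasMaj_idef_cut_knitG_of mv kk r hL a hmc.le hδmδc k (HC (mv + 1) kk r hk hL (coverCorner (cvM d L mv kk hL) (L ^ mv) L (coverMargin L mv) k))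
  have hIDc := fun k μ => hasMaj_idef_cutF_knitG_of (mh := mh) mv kk r hL a hme.le hδmδe k μ (HE (mv + 1) kk r hk hn4 hL (coverCorner (cvM d L mv kk hL) (L ^ mv) L (coverMargin L mv) k) μ)
  have hIDbc := fun k μ => hasMaj_idef_cutB_knitG_of (me := me) mv kk r hL a hmh.le hδmδh k μ (HH (mv + 1) kk r hk hn4 hL (coverCorner (cvM d L mv kk hL) (L ^ mv) L (coverMargin L mv) k) μ)
  -- the windows of the cut box about the partition cell (dag-n15-w4 V ∕ VII), radius 2, both spacings
  have hwin2 := fun μ k => chiCube_cover_lift_eq_one_of_near_bbox (n := L ^ kk) 2 ι hM hw hlo hhi hS6 μ k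
  have hwin := fun μ k => hcubeWindow_of_bumpWindow (2 * L) (fun ν (p : CvX d L mv kk hL × ι) => coverXi (cvM d L mv kk hL) (L ^ kk) (L ^ mv) ν p.1) 2
    (fun μ => liftEquiv (bshiftEquiv (cvM d L mv kk hL) (L ^ kk) μ) ι) μ (by norm_num) (hwin2 μ k)
  have hwin2' := fun μ k => chiCube_cover_lift_eq_one_of_near_bbox (n := L ^ r * L ^ kk) 2 ι hM hw hlo hhi hS6 μ k
  have hwin' := fun μ k => hcubeWindow_of_bumpWindow (2 * L) (fun ν (p : CvX' d L mv kk r hL × ι) => coverXi (cvM d L mv kk hL) (L ^ r * L ^ kk) (L ^ mv) ν p.1) 2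
    (fun μ => liftEquiv (bshiftEquiv (cvM d L mv kk hL) (L ^ r * L ^ kk) μ) ι) μ (by norm_num) (hwin2' μ k)
  -- the smallness (FILE 119 `cvSmall`, FILE 123b `cvSmallHalf`)
  have hq₀ := cv_q₀_le hβ0 hβ₁0 hcr0 hW1 hRdef; have hθsm := cv_θ_small hNov0 hcr0 (by positivity : (0 : ℝ) ≤ cι2) hβ0 hβ₁0 hθ₀def; have hεTle := cv_εT_le (dd := d) hcN₀0 hδm0 hWpos hC.le hcr0 hεT hκTdef; have hεTκ : εT ≤ κT := hεTle.trans (div_le_self hκT0 hW1)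
  have hsmall := cvSmall (Nov := Nov) (cr := cr) (cι2 := cι2) (cJ := (Fintype.card (Fin (d + 1)) : ℝ)) (β := β) (β₁ := β₁) (w := W) (R := R) (θF := θ₀) (ε₀ := εT)
    (ε := δm / 2) (E' := E') (cN₀ := cN₀) (D := (d : ℝ) + 1) (κ := κT)
    hNov0 hcr0 (by positivity) (by positivity) hβ0 hβ₁0 hW1 hR0.le hθ₀0.le (by positivity) hE'0 hcN₀0 (by positivity) hκT0 hq₀ hθsm hεTle hW0
  have hhalf := cvSmallHalf (Nov := Nov) (cr := cr) (cι2 := cι2) (cJ := (Fintype.card (Fin (d + 1)) : ℝ)) (β := β) (β₁ := β₁) (w := W) (R := R) (θF := θ₀) (ε₀ := εT)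
    (ε := δm / 2) (E' := E') (cN₀ := cN₀) (D := (d : ℝ) + 1) (κ := κT)
    hNov0 hcr0 (by positivity) (by positivity) hβ0 hβ₁0 hW1 hR0.le hθ₀0.le (by positivity) hE'0 hcN₀0 (by positivity) hκT0 hq₀ hθsm hεTle hW0
  -- the `κ·S` bounds of the two-grid letters
  have hsoχ : π * (d + 1) / (((L ^ kk : ℕ) : ℝ) * W) ≤ π * (d + 1) * Sdef := (by rw [div_eq_mul_inv]; exact mul_le_mul_of_nonneg_left (hnwε.trans hεS) (by positivity)); have hsoχ₁ : 2 * (π * (d + 1) / (((L ^ kk : ℕ) : ℝ) * W)) ≤ 2 * (π * (d + 1)) * Sdef := (by rw [mul_assoc]; exact mul_le_mul_of_nonneg_left hsoχ zero_le_two)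
  have hsoχ₂ : (W)⁻¹ * (((L ^ kk : ℕ) : ℝ) * W)⁻¹ * (32 * π ^ 4 + π ^ 2 * (d + 1)) ≤ (32 * π ^ 4 + π ^ 2 * (d + 1)) * Sdef :=
    calc (W)⁻¹ * (((L ^ kk : ℕ) : ℝ) * W)⁻¹ * (32 * π ^ 4 + π ^ 2 * (d + 1)) ≤ 1 * Sdef * (32 * π ^ 4 + π ^ 2 * (d + 1)) := mul_le_mul_of_nonneg_right (mul_le_mul hw1 (hnwε.trans hεS) (inv_nonneg.mpr (mul_nonneg hnR0.le hWpos.le)) zero_le_one) (by positivity)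
      _ = (32 * π ^ 4 + π ^ 2 * (d + 1)) * Sdef := by ring
  have hwabs : |W⁻¹| ≤ 1 := by rw [abs_of_nonneg (inv_nonneg.mpr hWpos.le)]; exact hw1
  have hso₁ : O1 ≤ (64 * π ^ 2 + π ^ 2 * Fintype.card (Fin (d + 1))) * Sdef :=
    calc O1 ≤ 1 * Sdef * (64 * π ^ 2 + π ^ 2 * Fintype.card (Fin (d + 1))) := mul_le_mul_of_nonneg_right (mul_le_mul hwabs (hnwε.trans hεS) (inv_nonneg.mpr (mul_nonneg hnR0.le hWpos.le)) zero_le_one) (by positivity)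
      _ = (64 * π ^ 2 + π ^ 2 * Fintype.card (Fin (d + 1))) * Sdef := by ring
  have hso₂ : O2 ≤ (144 * π ^ 3 + 32 * π ^ 3 * Fintype.card (Fin (d + 1))) * Sdef :=
    calc O2 ≤ 1 * Sdef * (144 * π ^ 3 + 32 * π ^ 3 * Fintype.card (Fin (d + 1))) := mul_le_mul_of_nonneg_right (mul_le_mul (pow_le_one₀ (inv_nonneg.mpr hWpos.le) hw1) (hnwε.trans hεS) (inv_nonneg.mpr (mul_nonneg hnR0.le hWpos.le)) zero_le_one) (by positivity)
      _ = (144 * π ^ 3 + 32 * π ^ 3 * Fintype.card (Fin (d + 1))) * Sdef := by ring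
  have hεk0' : 0 ≤ εk := hεk0; have hso : o ≤ 1 * Sdef := (by show o ≤ 1 * (εk + (o + (oW + rD))); linarith only [hεk0', hoW0, hrD]); have hsoW : oW ≤ 1 * Sdef := (by show oW ≤ 1 * (εk + (o + (oW + rD))); linarith only [hεk0', ho0, hrD])
  have hsrD : rD ≤ 1 * Sdef := (by show rD ≤ 1 * (εk + (o + (oW + rD))); linarith only [hεk0', ho0, hoW0]); have hsRN : RNK ≤ KRN * Sdef := cv_rN_le (by positivity) hE'0 hrr.le hcN₀0 hεk0 hεS hW1 hnwε
  have hsRF : RFK ≤ KRF * Sdef := cv_rF_le (by positivity) hcN₀0 hX1 hDp.le hεk0 hεS (by positivity) hC.le hnR0 hnε hoχ0 hsoχ hrr.le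
  have hsDη0 : (π / W) / η⁻¹ ≤ π * Sdef := by
    rw [hηinv, div_eq_mul_inv]; exact mul_le_mul (div_le_self pi_pos.le hW1) (hnε.trans hεS) (inv_nonneg.mpr hnR0.le) pi_pos.le
  have hsDη1 : (π / W) / η'⁻¹ ≤ π * Sdef := by
    rw [hη'inv, div_eq_mul_inv]; exact mul_le_mul (div_le_self pi_pos.le hW1) (hn'ε.trans hεS) (inv_nonneg.mpr hn'R0.le) pi_pos.le
  -- 53's hypotheses at the cover
  have hSχ' : ∀ k, ∀ x', (cvChi' d L mv kk r hL k) x' ≠ 0 → cvBlk d L mv kk hL ((kingPrV L kk r (cvM d L mv kk hL)) x') ∈ (cvSk d L mv kk hL k) := fun k x hx => blockOf_kingPrV_mem_cubeBlocks_of_inner_ne_zero hM hm₁ hfitI hS0 hx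
  have hSψ' : ∀ k, ∀ x', (cvPsi' d L mv kk r hL k) x' ≠ 0 → cvBlk d L mv kk hL ((kingPrV L kk r (cvM d L mv kk hL)) x') ∈ (cvSk d L mv kk hL k) := fun k x hx => blockOf_kingPrV_mem_cubeBlocks_of_chiCube_ne_zero hx
  have hdχt : ∀ k, ∀ μ p, |fgrad η⁻¹ (liftEquiv (bshiftEquiv (cvM d L mv kk hL) (L ^ kk) μ) ι) (fun p : CvX d L mv kk hL × ι => (cvBump d L mv kk hL k) p.1) p| ≤ (π / W) := by rw [hηinv]; exact fun k μ p => abs_fgrad_bcube_cover_lift_le 2 ι hM hw k μ p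
  have hdχtb : ∀ k, ∀ μ p, |bgrad η⁻¹ (liftEquiv (bshiftEquiv (cvM d L mv kk hL) (L ^ kk) μ) ι) (fun p : CvX d L mv kk hL × ι => (cvBump d L mv kk hL k) p.1) p| ≤ (π / W) := by rw [hηinv]; exact fun k μ p => abs_bgrad_bcube_cover_lift_le 2 ι hM hw k μ p
  have hdχt' : ∀ k, ∀ μ p', |fgrad η'⁻¹ (liftEquiv (bshiftEquiv (cvM d L mv kk hL) (L ^ r * L ^ kk) μ) ι) (fun p' : CvX' d L mv kk r hL × ι => (cvBump' d L mv kk r hL k) p'.1) p'| ≤ (π / W) := by rw [hη'inv]; exact fun k μ p => abs_fgrad_bcube_cover_lift_le 2 ι hM hw k μ p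
  have hdχtb' : ∀ k, ∀ μ p', |bgrad η'⁻¹ (liftEquiv (bshiftEquiv (cvM d L mv kk hL) (L ^ r * L ^ kk) μ) ι) (fun p' : CvX' d L mv kk r hL × ι => (cvBump' d L mv kk r hL k) p'.1) p'| ≤ (π / W) := by rw [hη'inv]; exact fun k μ p => abs_bgrad_bcube_cover_lift_le 2 ι hM hw k μ p
  have hsub' : ∀ k, mulOp (fun p : CvX' d L mv kk r hL × ι => (cvBump' d L mv kk r hL k) p.1) ∘ₗ mulOp (fun p : CvX' d L mv kk r hL × ι => (cvChi' d L mv kk r hL k) p.1) = mulOp (fun p : CvX' d L mv kk r hL × ι => (cvBump' d L mv kk r hL k) p.1) := fun k => bcube_cover_lift_cut 2 ι hM hw hlo hhi hS6 k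
  have hχ' : ∀ k, mulOp (fun p : CvX' d L mv kk r hL × ι => (cvChi' d L mv kk r hL k) p.1) ∘ₗ mulOp (fun p : CvX' d L mv kk r hL × ι => (cvBump' d L mv kk r hL k) p.1) = mulOp (fun p : CvX' d L mv kk r hL × ι => (cvBump' d L mv kk r hL k) p.1) := fun k => cut_bcube_cover_lift 2 ι hM hw hlo hhi hS6 k
  have hs' : ∀ k, ∀ μ, mulOp ((fun p' : CvX' d L mv kk r hL × ι => (cvBump' d L mv kk r hL k) p'.1) ∘ (liftEquiv (bshiftEquiv (cvM d L mv kk hL) (L ^ r * L ^ kk) μ) ι)) ∘ₗ mulOp (fun p' : CvX' d L mv kk r hL × ι => (cvChi' d L mv kk r hL k) p'.1) = mulOp ((fun p' : CvX' d L mv kk r hL × ι => (cvBump' d L mv kk r hL k) p'.1) ∘ (liftEquiv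
      (bshiftEquiv (cvM d L mv kk hL) (L ^ r * L ^ kk) μ) ι)) := fun k μ => bcube_cover_lift_comp_shift_cut 2 ι hM hw hlo hhi hS6 k μ
  have hsb' : ∀ k, ∀ μ, mulOp ((fun p' : CvX' d L mv kk r hL × ι => (cvBump' d L mv kk r hL k) p'.1) ∘ (liftEquiv (bshiftEquiv (cvM d L mv kk hL) (L ^ r * L ^ kk) μ) ι).symm) ∘ₗ mulOp (fun p' : CvX' d L mv kk r hL × ι => (cvChi' d L mv kk r hL k) p'.1) = mulOp ((fun p' : CvX' d L mv kk r hL × ι => (cvBump' d L mv kk r hL k) p'.1) ∘ (liftEquiv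
      (bshiftEquiv (cvM d L mv kk hL) (L ^ r * L ^ kk) μ) ι).symm) := fun k μ => bcube_cover_lift_comp_shift_symm_cut 2 ι hM hw hlo hhi hS6 k μ
  have hdd' : ∀ k, ∀ μ, mulOp (fgrad η'⁻¹ (liftEquiv (bshiftEquiv (cvM d L mv kk hL) (L ^ r * L ^ kk) μ) ι) (fun p' : CvX' d L mv kk r hL × ι => (cvBump' d L mv kk r hL k) p'.1)) ∘ₗ mulOp (fun p' : CvX' d L mv kk r hL × ι => (cvChi' d L mv kk r hL k) p'.1) = mulOp (fgrad η'⁻¹ (liftEquiv (bshiftEquiv (cvM d L mv kk hL) (L ^ r * L ^ kk) μ) ι)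
      (fun p' : CvX' d L mv kk r hL × ι => (cvBump' d L mv kk r hL k) p'.1)) := fun k μ => fgrad_bcube_cover_lift_cut 2 ι hM hw hlo hhi hS6 η'⁻¹ k μ
  have hddb' : ∀ k, ∀ μ, mulOp (bgrad η'⁻¹ (liftEquiv (bshiftEquiv (cvM d L mv kk hL) (L ^ r * L ^ kk) μ) ι) (fun p' : CvX' d L mv kk r hL × ι => (cvBump' d L mv kk r hL k) p'.1)) ∘ₗ mulOp (fun p' : CvX' d L mv kk r hL × ι => (cvChi' d L mv kk r hL k) p'.1) = mulOp (bgrad η'⁻¹ (liftEquiv (bshiftEquiv (cvM d L mv kk hL) (L ^ r * L ^ kk) μ) ι)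
      (fun p' : CvX' d L mv kk r hL × ι => (cvBump' d L mv kk r hL k) p'.1)) := fun k μ => bgrad_bcube_cover_lift_cut 2 ι hM hw hlo hhi hS6 η'⁻¹ k μ
  have hNψ' : ∀ k, (cvCube' d L mv kk r hL a ι k) ∘ₗ mulOp (fun p : CvX' d L mv kk r hL × ι => (cvPsi' d L mv kk r hL k) p.1) = (cvCube' d L mv kk r hL a ι k) := fun k => cube_comp_psi_cover_lift (m₀ := coverMargin L mv) ι hM ha k
  have hfitχ : ∀ k, ∀ x', |(cvBump' d L mv kk r hL k) x' - (cvBump d L mv kk hL k) ((kingPrV L kk r (cvM d L mv kk hL)) x')| ≤ (π * (d + 1) / (((L ^ kk : ℕ) : ℝ) * W)) := fun k x' => abs_bcube_cover_fine_sub_le (L := L) (kk := kk) (r := r) 2 hM hw k x'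
  have hfit₁ : ∀ k, ∀ μ p', |((fun p' : CvX' d L mv kk r hL × ι => (cvBump' d L mv kk r hL k) p'.1) ∘ (liftEquiv (bshiftEquiv (cvM d L mv kk hL) (L ^ r * L ^ kk) μ) ι)) p' - ((fun p : CvX d L mv kk hL × ι => (cvBump d L mv kk hL k) p.1) ∘ (liftEquiv (bshiftEquiv (cvM d L mv kk hL) (L ^ kk) μ) ι)) (liftMap (kingPrV L kk r (cvM d L mv kk hL)) ι
      p')| ≤ (2 * (π * (d + 1) / (((L ^ kk : ℕ) : ℝ) * W))) := fun k μ p' => (abs_bcube_cover_lift_shift_fine_sub_le 2 ι hM hw k μ p').trans (le_mul_of_one_le_left hoχ0 one_le_two)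
  have hfit₁b : ∀ k, ∀ μ p', |((fun p' : CvX' d L mv kk r hL × ι => (cvBump' d L mv kk r hL k) p'.1) ∘ (liftEquiv (bshiftEquiv (cvM d L mv kk hL) (L ^ r * L ^ kk) μ) ι).symm) p' - ((fun p : CvX d L mv kk hL × ι => (cvBump d L mv kk hL k) p.1) ∘ (liftEquiv (bshiftEquiv (cvM d L mv kk hL) (L ^ kk) μ) ι).symm) (liftMap (kingPrV L kk r (cvM d L mv
      kk hL)) ι p')| ≤ (2 * (π * (d + 1) / (((L ^ kk : ℕ) : ℝ) * W))) := fun k μ p' => abs_bcube_cover_lift_shift_symm_fine_sub_le 2 ι hM hw k μ p'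
  have hfit₂ : ∀ k, ∀ μ p', |fgrad η'⁻¹ (liftEquiv (bshiftEquiv (cvM d L mv kk hL) (L ^ r * L ^ kk) μ) ι) (fun p' : CvX' d L mv kk r hL × ι => (cvBump' d L mv kk r hL k) p'.1) p' - fgrad η⁻¹ (liftEquiv (bshiftEquiv (cvM d L mv kk hL) (L ^ kk) μ) ι) (fun p : CvX d L mv kk hL × ι => (cvBump d L mv kk hL k) p.1) (liftMap (kingPrV L kk r (cvM d L
      mv kk hL)) ι p')| ≤ ((W)⁻¹ * (((L ^ kk : ℕ) : ℝ) * W)⁻¹ * (32 * π ^ 4 + π ^ 2 * (d + 1))) := by rw [hηinv, hη'inv]; exact fun k μ p' => abs_fgrad_bcube_cover_lift_two_grid_le 2 ι hM hw zero_le_two hRq k μ p'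
  have hfit₂b : ∀ k, ∀ μ p', |bgrad η'⁻¹ (liftEquiv (bshiftEquiv (cvM d L mv kk hL) (L ^ r * L ^ kk) μ) ι) (fun p' : CvX' d L mv kk r hL × ι => (cvBump' d L mv kk r hL k) p'.1) p' - bgrad η⁻¹ (liftEquiv (bshiftEquiv (cvM d L mv kk hL) (L ^ kk) μ) ι) (fun p : CvX d L mv kk hL × ι => (cvBump d L mv kk hL k) p.1) (liftMap (kingPrV L kk r (cvM d L
      mv kk hL)) ι p')| ≤ ((W)⁻¹ * (((L ^ kk : ℕ) : ℝ) * W)⁻¹ * (32 * π ^ 4 + π ^ 2 * (d + 1))) := by rw [hηinv, hη'inv]; exact fun k μ p' => abs_bgrad_bcube_cover_lift_two_grid_le 2 ι hM hw zero_le_two hRq k μ p'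
  have hcut' : ∀ k, HasMaj (BlockNorm.ofBlocks (unitTorusGeo L kk (cvM d L mv kk hL)) (liftBlk (cvBlk d L mv kk hL ∘ (kingPrV L kk r (cvM d L mv kk hL))) ι)) (BlockNorm.ofBlocks (unitTorusGeo L kk (cvM d L mv kk hL)) (liftBlk (cvBlk d L mv kk hL ∘ (kingPrV L kk r (cvM d L mv kk hL))) ι)) (mulOp (fun p : CvX' d L mv kk r hL × ι => (cvChi' d L
      mv kk r hL k) p.1) ∘ₗ (cvCube' d L mv kk r hL a ι k)) (fun y y' => ind (g := unitTorusGeo L kk (cvM d L mv kk hL)) (cvSk d L mv kk hL k) y * ind (g := unitTorusGeo L kk (cvM d L mv kk hL)) (cvSk d L mv kk hL k) y' * (β * Real.exp (-(δm * (unitTorusGeo L kk (cvM d L mv kk hL)).dist y y')))) := fun k => hasMaj_src_tgt_congr (liftBlk_blkCover_comp_kingPrV ι).symm (hasMaj_cut_cover_lift (m₀ := coverMargin L mv) ι hM hm₁ hfitI hS0 hC.le hδ₀.le hδmδ₀ hG' k)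
  have hcutF' : ∀ k, ∀ μ, HasMaj (BlockNorm.ofBlocks (unitTorusGeo L kk (cvM d L mv kk hL)) (liftBlk (cvBlk d L mv kk hL ∘ (kingPrV L kk r (cvM d L mv kk hL))) ι)) (BlockNorm.ofBlocks (unitTorusGeo L kk (cvM d L mv kk hL)) (liftBlk (cvBlk d L mv kk hL ∘ (kingPrV L kk r (cvM d L mv kk hL))) ι)) (mulOp (fun p : CvX' d L mv kk r hL × ι => (cvChi'
      d L mv kk r hL k) p.1) ∘ₗ (fgrad η'⁻¹ (liftEquiv (bshiftEquiv (cvM d L mv kk hL) (L ^ r * L ^ kk) μ) ι) ∘ₗ (cvCube' d L mv kk r hL a ι k))) (fun y y' => ind (g := unitTorusGeo L kk (cvM d L mv kk hL)) (cvSk d L mv kk hL k) y * ind (g := unitTorusGeo L kk (cvM d L mv kk hL)) (cvSk d L mv kk hL k) y' * (β₁ * Real.exp (-(δm *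
      (unitTorusGeo L kk (cvM d L mv kk hL)).dist y y')))) := fun k μ => hasMaj_src_tgt_congr (liftBlk_blkCover_comp_kingPrV ι).symm (hasMaj_cutF_cover_lift (m₀ := coverMargin L mv) ι hM hm₁ hfitI hS0 hC hδ₀ hδmδ₀ hη'inv μ (hD' μ) k)
  have hcutB' : ∀ k, ∀ μ, HasMaj (BlockNorm.ofBlocks (unitTorusGeo L kk (cvM d L mv kk hL)) (liftBlk (cvBlk d L mv kk hL ∘ (kingPrV L kk r (cvM d L mv kk hL))) ι)) (BlockNorm.ofBlocks (unitTorusGeo L kk (cvM d L mv kk hL)) (liftBlk (cvBlk d L mv kk hL ∘ (kingPrV L kk r (cvM d L mv kk hL))) ι)) (mulOp (fun p : CvX' d L mv kk r hL × ι => (cvChi'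
      d L mv kk r hL k) p.1) ∘ₗ (bgrad η'⁻¹ (liftEquiv (bshiftEquiv (cvM d L mv kk hL) (L ^ r * L ^ kk) μ) ι) ∘ₗ (cvCube' d L mv kk r hL a ι k))) (fun y y' => ind (g := unitTorusGeo L kk (cvM d L mv kk hL)) (cvSk d L mv kk hL k) y * ind (g := unitTorusGeo L kk (cvM d L mv kk hL)) (cvSk d L mv kk hL k) y' * (β₁ * Real.exp (-(δm *
      (unitTorusGeo L kk (cvM d L mv kk hL)).dist y y')))) := fun k μ => hasMaj_src_tgt_congr (liftBlk_blkCover_comp_kingPrV ι).symm (hasMaj_cutB_cover_lift (m₀ := coverMargin L mv) ι hM hm₁ hfitI hS0 hC hδ₀ hδmδ₀ hη'inv μ (hD' μ) k)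
  have hDcut : ∀ k, HasMaj (CvNorm d L mv kk hL ι) (BlockNorm.ofBlocks (unitTorusGeo L kk (cvM d L mv kk hL)) (liftBlk (cvBlk d L mv kk hL) ι ∘ liftMap (kingPrV L kk r (cvM d L mv kk hL)) ι)) (idef (pull (liftMap (kingPrV L kk r (cvM d L mv kk hL)) ι)) (pull (liftMap (kingPrV L kk r (cvM d L mv kk hL)) ι)) (mulOp (fun p : CvX' d L mv kk r hL ×
      ι => (cvChi' d L mv kk r hL k) p.1) ∘ₗ (cvCube' d L mv kk r hL a ι k)) (mulOp (fun p : CvX d L mv kk hL × ι => (cvChi d L mv kk hL k) p.1) ∘ₗ (cvCube d L mv kk hL a ι k))) (fun y y' => ind (g := unitTorusGeo L kk (cvM d L mv kk hL)) (cvSk d L mv kk hL k) y * ind (g := unitTorusGeo L kk (cvM d L mv kk hL)) (cvSk d L mv kk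
      hL k) y' * ((mc * εk) * Real.exp (-(δm * (unitTorusGeo L kk (cvM d L mv kk hL)).dist y y')))) := fun k => hasMaj_idef_cut_cover_lift (m₀ := coverMargin L mv) ι hM hm₁ hfitI hS0 k (hKc k) (hIGc k)
  have hDcutF : ∀ k, ∀ μ, HasMaj (CvNorm d L mv kk hL ι) (BlockNorm.ofBlocks (unitTorusGeo L kk (cvM d L mv kk hL)) (liftBlk (cvBlk d L mv kk hL) ι ∘ liftMap (kingPrV L kk r (cvM d L mv kk hL)) ι)) (idef (pull (liftMap (kingPrV L kk r (cvM d L mv kk hL)) ι)) (pull (liftMap (kingPrV L kk r (cvM d L mv kk hL)) ι)) (mulOp (fun p : CvX' d L mv kk r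
      hL × ι => (cvChi' d L mv kk r hL k) p.1) ∘ₗ (fgrad η'⁻¹ (liftEquiv (bshiftEquiv (cvM d L mv kk hL) (L ^ r * L ^ kk) μ) ι) ∘ₗ (cvCube' d L mv kk r hL a ι k))) (mulOp (fun p : CvX d L mv kk hL × ι => (cvChi d L mv kk hL k) p.1) ∘ₗ (fgrad η⁻¹ (liftEquiv (bshiftEquiv (cvM d L mv kk hL) (L ^ kk) μ) ι) ∘ₗ (cvCube d L mv kk hL a
      ι k)))) (fun y y' => ind (g := unitTorusGeo L kk (cvM d L mv kk hL)) (cvSk d L mv kk hL k) y * ind (g := unitTorusGeo L kk (cvM d L mv kk hL)) (cvSk d L mv kk hL k) y' * ((max me mh * εk) * Real.exp (-(δm * (unitTorusGeo L kk (cvM d L mv kk hL)).dist y y')))) := by rw [hηinv, hη'inv]; exact fun k μ => hasMaj_idef_cutF_cover_lift (m₀ := coverMargin L mv) ι hM hm₁ hfitI hS0 k _ _ μ (hKe k) (hIDc k μ)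
  have hDcutB : ∀ k, ∀ μ, HasMaj (CvNorm d L mv kk hL ι) (BlockNorm.ofBlocks (unitTorusGeo L kk (cvM d L mv kk hL)) (liftBlk (cvBlk d L mv kk hL) ι ∘ liftMap (kingPrV L kk r (cvM d L mv kk hL)) ι)) (idef (pull (liftMap (kingPrV L kk r (cvM d L mv kk hL)) ι)) (pull (liftMap (kingPrV L kk r (cvM d L mv kk hL)) ι)) (mulOp (fun p : CvX' d L mv kk r
      hL × ι => (cvChi' d L mv kk r hL k) p.1) ∘ₗ (bgrad η'⁻¹ (liftEquiv (bshiftEquiv (cvM d L mv kk hL) (L ^ r * L ^ kk) μ) ι) ∘ₗ (cvCube' d L mv kk r hL a ι k))) (mulOp (fun p : CvX d L mv kk hL × ι => (cvChi d L mv kk hL k) p.1) ∘ₗ (bgrad η⁻¹ (liftEquiv (bshiftEquiv (cvM d L mv kk hL) (L ^ kk) μ) ι) ∘ₗ (cvCube d L mv kk hL a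
      ι k)))) (fun y y' => ind (g := unitTorusGeo L kk (cvM d L mv kk hL)) (cvSk d L mv kk hL k) y * ind (g := unitTorusGeo L kk (cvM d L mv kk hL)) (cvSk d L mv kk hL k) y' * ((max me mh * εk) * Real.exp (-(δm * (unitTorusGeo L kk (cvM d L mv kk hL)).dist y y')))) := by rw [hηinv, hη'inv]; exact fun k μ => hasMaj_idef_cutB_cover_lift (m₀ := coverMargin L mv) ι hM hm₁ hfitI hS0 k _ _ μ (hKe k) (hIDbc k μ)
  have hs2' : ∀ k, ∀ μ, mulOp (fun p' : CvX' d L mv kk r hL × ι => (cvChi' d L mv kk r hL k) p'.1) ∘ₗ mulOp ((fun p' : CvX' d L mv kk r hL × ι => (cvBump' d L mv kk r hL k) p'.1) ∘ (liftEquiv (bshiftEquiv (cvM d L mv kk hL) (L ^ r * L ^ kk) μ) ι)) = mulOp ((fun p' : CvX' d L mv kk r hL × ι => (cvBump' d L mv kk r hL k) p'.1) ∘ (liftEquiv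
      (bshiftEquiv (cvM d L mv kk hL) (L ^ r * L ^ kk) μ) ι)) := fun k μ => cut_bcube_cover_lift_comp_shift 2 ι hM hw hlo hhi hS6 k μ
  have hsb2' : ∀ k, ∀ μ, mulOp (fun p' : CvX' d L mv kk r hL × ι => (cvChi' d L mv kk r hL k) p'.1) ∘ₗ mulOp ((fun p' : CvX' d L mv kk r hL × ι => (cvBump' d L mv kk r hL k) p'.1) ∘ (liftEquiv (bshiftEquiv (cvM d L mv kk hL) (L ^ r * L ^ kk) μ) ι).symm) = mulOp ((fun p' : CvX' d L mv kk r hL × ι => (cvBump' d L mv kk r hL k) p'.1) ∘ (liftEquiv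
      (bshiftEquiv (cvM d L mv kk hL) (L ^ r * L ^ kk) μ) ι).symm) := fun k μ => cut_bcube_cover_lift_comp_shift_symm 2 ι hM hw hlo hhi hS6 k μ
  have hdd2' : ∀ k, ∀ μ, mulOp (fun p' : CvX' d L mv kk r hL × ι => (cvChi' d L mv kk r hL k) p'.1) ∘ₗ mulOp (fgrad η'⁻¹ (liftEquiv (bshiftEquiv (cvM d L mv kk hL) (L ^ r * L ^ kk) μ) ι) (fun p' : CvX' d L mv kk r hL × ι => (cvBump' d L mv kk r hL k) p'.1)) = mulOp (fgrad η'⁻¹ (liftEquiv (bshiftEquiv (cvM d L mv kk hL) (L ^ r * L ^ kk) μ) ι)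
      (fun p' : CvX' d L mv kk r hL × ι => (cvBump' d L mv kk r hL k) p'.1)) := fun k μ => cut_fgrad_bcube_cover_lift 2 ι hM hw hlo hhi hS6 η'⁻¹ k μ
  have hddb2' : ∀ k, ∀ μ, mulOp (fun p' : CvX' d L mv kk r hL × ι => (cvChi' d L mv kk r hL k) p'.1) ∘ₗ mulOp (bgrad η'⁻¹ (liftEquiv (bshiftEquiv (cvM d L mv kk hL) (L ^ r * L ^ kk) μ) ι) (fun p' : CvX' d L mv kk r hL × ι => (cvBump' d L mv kk r hL k) p'.1)) = mulOp (bgrad η'⁻¹ (liftEquiv (bshiftEquiv (cvM d L mv kk hL) (L ^ r * L ^ kk) μ) ι)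
      (fun p' : CvX' d L mv kk r hL × ι => (cvBump' d L mv kk r hL k) p'.1)) := fun k μ => cut_bgrad_bcube_cover_lift 2 ι hM hw hlo hhi hS6 η'⁻¹ k μ
  have hh1 : ∀ k, ∀ μ p, |fgrad η⁻¹ (liftEquiv (bshiftEquiv (cvM d L mv kk hL) (L ^ kk) μ) ι) (fun p : CvX d L mv kk hL × ι => knitH d L mv kk (L ^ kk) hL k p.1) p| ≤ (π / W) := by rw [hηinv]; exact fun k μ p => abs_fgrad_coverH_lift_le ι hM hw k μ p
  have hh1b : ∀ k, ∀ μ p, |bgrad η⁻¹ (liftEquiv (bshiftEquiv (cvM d L mv kk hL) (L ^ kk) μ) ι) (fun p : CvX d L mv kk hL × ι => knitH d L mv kk (L ^ kk) hL k p.1) p| ≤ (π / W) := by rw [hηinv]; exact fun k μ p => abs_bgrad_coverH_lift_le ι hM hw k μ p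
  have hh1' : ∀ k, ∀ μ p', |fgrad η'⁻¹ (liftEquiv (bshiftEquiv (cvM d L mv kk hL) (L ^ r * L ^ kk) μ) ι) (fun p : CvX' d L mv kk r hL × ι => knitH d L mv kk (L ^ r * L ^ kk) hL k p.1) p'| ≤ (π / W) := by rw [hη'inv]; exact fun k μ p => abs_fgrad_coverH_lift_le ι hM hw k μ p
  have hh1b' : ∀ k, ∀ μ p', |bgrad η'⁻¹ (liftEquiv (bshiftEquiv (cvM d L mv kk hL) (L ^ r * L ^ kk) μ) ι) (fun p : CvX' d L mv kk r hL × ι => knitH d L mv kk (L ^ r * L ^ kk) hL k p.1) p'| ≤ (π / W) := by rw [hη'inv]; exact fun k μ p => abs_bgrad_coverH_lift_le ι hM hw k μ p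
  have hh2' : ∀ k, ∀ μ p', |fgradAdj η'⁻¹ (liftEquiv (bshiftEquiv (cvM d L mv kk hL) (L ^ r * L ^ kk) μ) ι) (fgrad η'⁻¹ (liftEquiv (bshiftEquiv (cvM d L mv kk hL) (L ^ r * L ^ kk) μ) ι) (fun p : CvX' d L mv kk r hL × ι => knitH d L mv kk (L ^ r * L ^ kk) hL k p.1)) p'| ≤ (32 * π ^ 2 / W ^ 2) := by rw [hη'inv]; exact fun k μ p => abs_fgradAdj_fgrad_coverH_lift_le ι hM hw k μ p
  have hf1 : ∀ k, ∀ μ p', |fgrad η'⁻¹ (liftEquiv (bshiftEquiv (cvM d L mv kk hL) (L ^ r * L ^ kk) μ) ι) (fun p : CvX' d L mv kk r hL × ι => knitH d L mv kk (L ^ r * L ^ kk) hL k p.1) p' - fgrad η⁻¹ (liftEquiv (bshiftEquiv (cvM d L mv kk hL) (L ^ kk) μ) ι) (fun p : CvX d L mv kk hL × ι => knitH d L mv kk (L ^ kk) hL k p.1) (liftMap (kingPrV L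
      kk r (cvM d L mv kk hL)) ι p')| ≤ O1 := by rw [hηinv, hη'inv]; exact fun k μ p' => abs_fgrad_coverH_lift_two_grid_le ι hM hw h3 k μ p'
  have hf1b : ∀ k, ∀ μ p', |bgrad η'⁻¹ (liftEquiv (bshiftEquiv (cvM d L mv kk hL) (L ^ r * L ^ kk) μ) ι) (fun p : CvX' d L mv kk r hL × ι => knitH d L mv kk (L ^ r * L ^ kk) hL k p.1) p' - bgrad η⁻¹ (liftEquiv (bshiftEquiv (cvM d L mv kk hL) (L ^ kk) μ) ι) (fun p : CvX d L mv kk hL × ι => knitH d L mv kk (L ^ kk) hL k p.1) (liftMap (kingPrV L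
      kk r (cvM d L mv kk hL)) ι p')| ≤ O1 := by rw [hηinv, hη'inv]; exact fun k μ p' => abs_bgrad_coverH_lift_two_grid_le ι hM hw h3 k μ p'
  have hf2 : ∀ k, ∀ μ p', |fgradAdj η'⁻¹ (liftEquiv (bshiftEquiv (cvM d L mv kk hL) (L ^ r * L ^ kk) μ) ι) (fgrad η'⁻¹ (liftEquiv (bshiftEquiv (cvM d L mv kk hL) (L ^ r * L ^ kk) μ) ι) (fun p : CvX' d L mv kk r hL × ι => knitH d L mv kk (L ^ r * L ^ kk) hL k p.1)) p' - fgradAdj η⁻¹ (liftEquiv (bshiftEquiv (cvM d L mv kk hL) (L ^ kk) μ) ι)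
      (fgrad η⁻¹ (liftEquiv (bshiftEquiv (cvM d L mv kk hL) (L ^ kk) μ) ι) (fun p : CvX d L mv kk hL × ι => knitH d L mv kk (L ^ kk) hL k p.1)) (liftMap (kingPrV L kk r (cvM d L mv kk hL)) ι p')| ≤ O2 := by rw [hηinv, hη'inv]; exact fun k μ p' => abs_fgradAdj_fgrad_coverH_lift_two_grid_le ι hM hw h3 k μ p'
  have hrh' : ∀ k (p' : CvX' d L mv kk r hL × ι), |knitH d L mv kk (L ^ r * L ^ kk) hL k p'.1 - (coverHb (cvM d L mv kk hL) (L ^ kk) (L ^ mv) L k) (liftBlk (cvBlk d L mv kk hL ∘ (kingPrV L kk r (cvM d L mv kk hL))) ι p')| ≤ (π * (d + 1) / W) := fun k p' => abs_coverH_sub_coverHb_kingPrV_le ι hM hw k p'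
  have hfh : ∀ k (p' : CvX' d L mv kk r hL × ι), |knitH d L mv kk (L ^ r * L ^ kk) hL k p'.1 - knitH d L mv kk (L ^ kk) hL k ((kingPrV L kk r (cvM d L mv kk hL)) p'.1)| ≤ (π * (d + 1) / (((L ^ kk : ℕ) : ℝ) * W)) := fun k p' => abs_coverH_fine_sub_le kk r hM hw k p'.1
  have hstep : ∀ μ x, (unitTorusGeo L kk (cvM d L mv kk hL)).dist ((cvBlk d L mv kk hL) (bshiftEquiv (cvM d L mv kk hL) (L ^ kk) μ x)) ((cvBlk d L mv kk hL) x) ≤ (1:ℝ) := fun μ x => by have h := tdistT_blockOf_sub_unitVec_le (L ^ kk) (cvM d L mv kk hL) (x.1 + unitVec (fine (L ^ kk) (cvM d L mv kk hL)) μ) μ; rw [add_sub_cancel_right, tdistT_symm] at h; exact h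
  have hstep' : ∀ μ x', (unitTorusGeo L kk (cvM d L mv kk hL)).dist (cvBlk d L mv kk hL ((kingPrV L kk r (cvM d L mv kk hL)) (bshiftEquiv (cvM d L mv kk hL) (L ^ r * L ^ kk) μ x'))) (cvBlk d L mv kk hL ((kingPrV L kk r (cvM d L mv kk hL)) x')) ≤ (1:ℝ) := fun μ x' => dist_blockOf_kingPrV_step_le μ x'
  have hKN' : ∀ k, HasMaj (BlockNorm.ofBlocks (unitTorusGeo L kk (cvM d L mv kk hL)) (liftBlk (cvBlk d L mv kk hL ∘ (kingPrV L kk r (cvM d L mv kk hL))) ι)) (BlockNorm.ofBlocks (unitTorusGeo L kk (cvM d L mv kk hL)) (liftBlk (cvBlk d L mv kk hL ∘ (kingPrV L kk r (cvM d L mv kk hL))) ι)) (commOp (cvNL' d L mv kk r hL a ι) (fun p : CvX' d L mv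
      kk r hL × ι => knitH d L mv kk (L ^ r * L ^ kk) hL k p.1)) (fun y y' => ((π * (d + 1) / W * (Real.exp 1 * (δm / 2))⁻¹ + 2 * (π * (d + 1) / W)) * cN₀) * Real.exp (-((δm - δm / 2) * (unitTorusGeo L kk (cvM d L mv kk hL)).dist y y'))) := fun k => hasMaj_src_tgt_congr (liftBlk_blkCover_comp_kingPrV ι).symm (hasMaj_commOp_nonlocal_cover_lift (δN := δm) ι hM hw hC₁.le hδm0.le hδmδ₁ (half_pos hδm0) hNL' k)
  have hDKN : ∀ k, HasMaj (CvNorm d L mv kk hL ι) (BlockNorm.ofBlocks (unitTorusGeo L kk (cvM d L mv kk hL)) (liftBlk (cvBlk d L mv kk hL ∘ (kingPrV L kk r (cvM d L mv kk hL))) ι)) (idef (pull (liftMap (kingPrV L kk r (cvM d L mv kk hL)) ι)) (pull (liftMap (kingPrV L kk r (cvM d L mv kk hL)) ι)) (commOp (cvNL' d L mv kk r hL a ι) (fun p :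
      CvX' d L mv kk r hL × ι => knitH d L mv kk (L ^ r * L ^ kk) hL k p.1)) (commOp (cvNL d L mv kk hL a ι) (fun p : CvX d L mv kk hL × ι => knitH d L mv kk (L ^ kk) hL k p.1))) (fun y y' => RNK * Real.exp (-((δm - δm / 2) * (unitTorusGeo L kk (cvM d L mv kk hL)).dist y y'))) := fun k => hasMaj_idef_commOp_nonlocal_cover_lift ι hM hw k hcN₀0 (mul_nonneg hrr.le hεk0) (half_pos hδm0) hNsc hNsc' hDNsc
  have hh2 : ∀ k, ∀ μ p, |fgradAdj η⁻¹ (liftEquiv (bshiftEquiv (cvM d L mv kk hL) (L ^ kk) μ) ι) (fgrad η⁻¹ (liftEquiv (bshiftEquiv (cvM d L mv kk hL) (L ^ kk) μ) ι) (fun p : CvX d L mv kk hL × ι => knitH d L mv kk (L ^ kk) hL k p.1)) p| ≤ (32 * π ^ 2 / W ^ 2) := by rw [hηinv]; exact fun k μ p => abs_fgradAdj_fgrad_coverH_lift_le ι hM hw k μ p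
  have hhcut' : ∀ k, mulOp (fun p : CvX' d L mv kk r hL × ι => knitH d L mv kk (L ^ r * L ^ kk) hL k p.1) ∘ₗ mulOp (fun p : CvX' d L mv kk r hL × ι => cvChi' d L mv kk r hL k p.1) = mulOp (fun p : CvX' d L mv kk r hL × ι => knitH d L mv kk (L ^ r * L ^ kk) hL k p.1) := fun k => hcube_cut (2 * L) (fun ν (p : CvX' d L mv kk r hL × ι) => coverXi (cvM d L mv kk hL) (L ^ r * L ^ kk) (L ^ mv) ν p.1) (fun μ => liftEquiv (bshiftEquiv (cvM d L mv kk hL) (L ^ r * L ^ kk) μ) ι) 0 (hwin' 0 k)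
  have hT' : ∀ k, HasMaj (BlockNorm.ofBlocks (unitTorusGeo L kk (cvM d L mv kk hL)) (liftBlk (cvBlk d L mv kk hL ∘ (kingPrV L kk r (cvM d L mv kk hL))) ι)) (BlockNorm.ofBlocks (unitTorusGeo L kk (cvM d L mv kk hL)) (liftBlk (cvBlk d L mv kk hL ∘ (kingPrV L kk r (cvM d L mv kk hL))) ι)) ((-(mulOp (fun p : CvX' d L mv kk r hL × ι => knitH d L
      mv kk (L ^ r * L ^ kk) hL k p.1) ∘ₗ (cvNL' d L mv kk r hL a ι) ∘ₗ mulOp (1 - fun p : CvX' d L mv kk r hL × ι => cvBump' d L mv kk r hL k p.1))) ∘ₗ (cvCube' d L mv kk r hL a ι k)) (fun y y' => ind (g := unitTorusGeo L kk (cvM d L mv kk hL)) (cvSk d L mv kk hL k) y * ind (g := unitTorusGeo L kk (cvM d L mv kk hL)) (cvSk d L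
      mv kk hL k) y' * (εT * Real.exp (-((δm / 2) * (unitTorusGeo L kk (cvM d L mv kk hL)).dist y y')))) := fun k => hasMaj_src_tgt_congr (liftBlk_blkCover_comp_kingPrV ι).symm (hasMaj_tail_cover_lift (m₀ := coverMargin L mv) (δN := δm) (ρ₁ := 3 * δm / 4) (ρ := δm / 2) ι hM hM' hw hL2 hfit hS0 htri0 hrow hC.le hδ₀.le hC₁.le hδm0.le hδmδ₁ (by linarith only [hδm0]) (by positivity) (by linarith only [hδmδ₀, hδm0]) (by linarith only [hδm0]) hG' hNL' k)
  have hDT := fun k => hasMaj_idef_tail_cover_lift (m₀ := coverMargin L mv) (δ₀ := δm) (δN := δm) (ρ₁ := 3 * δm / 4) (ρ := δm / 2) (σ := δm / 32) ι hM hM' hw hL2 hmw hfit hS0 ha htri0 hrow hC.le (mul_nonneg hDp.le hεk0) hC.le hδm0.le hC₁.le hδm0.le hδmδ₁ (mul_nonneg hrr.le hεk0) (by linarith only [hδm0]) (by positivity) (by linarith only [hδm0]) (by linarith only [hδm0]) hGm h0m hDm hNL hNL' hDNsc0 k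
  have hψχ' : ∀ k, mulOp (fun p : CvX' d L mv kk r hL × ι => cvPsi' d L mv kk r hL k p.1) ∘ₗ mulOp (fun p : CvX' d L mv kk r hL × ι => cvChi' d L mv kk r hL k p.1) = mulOp (fun p : CvX' d L mv kk r hL × ι => cvChi' d L mv kk r hL k p.1) := fun k => mulOp_comp_mulOp_of_support_left fun p hp => chiCube_eq_one_of_inner_ne_zero hM hm₁ hfitI hS0 hp
  have hhψf : ∀ k, mulOp (fun p : CvX' d L mv kk r hL × ι => knitH d L mv kk (L ^ r * L ^ kk) hL k p.1) ∘ₗ mulOp (fun p : CvX' d L mv kk r hL × ι => cvPsi' d L mv kk r hL k p.1) = mulOp (fun p : CvX' d L mv kk r hL × ι => knitH d L mv kk (L ^ r * L ^ kk) hL k p.1) := fun k => mulOp_comp_mulOp_of_support fun p hp => chiCube_coverCorner_eq_one hM hw hfit 0 k p.1 ⟨p.1, Or.inl rfl, abs_cenRep_lt_one_of_hcube_ne_zero (2 * L) (coverXi (cvM d L mv kk hL) (L ^ r * L ^ kk) (L ^ mv)) hp⟩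
  have hχhf : ∀ k, mulOp (fun p : CvX' d L mv kk r hL × ι => cvChi' d L mv kk r hL k p.1) ∘ₗ mulOp (fun p : CvX' d L mv kk r hL × ι => knitH d L mv kk (L ^ r * L ^ kk) hL k p.1) = mulOp (fun p : CvX' d L mv kk r hL × ι => knitH d L mv kk (L ^ r * L ^ kk) hL k p.1) := fun k => cut_hcube (2 * L) (fun ν (p : CvX' d L mv kk r hL × ι) => coverXi (cvM d L mv kk hL) (L ^ r * L ^ kk) (L ^ mv) ν p.1) 2 (fun μ => liftEquiv (bshiftEquiv (cvM d L mv kk hL) (L ^ r * L ^ kk) μ) ι) 0 (by norm_num) (hwin2' 0 k)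
  have hhsf : ∀ k μ, mulOp (fun p : CvX' d L mv kk r hL × ι => cvChi' d L mv kk r hL k p.1) ∘ₗ mulOp ((fun p : CvX' d L mv kk r hL × ι => knitH d L mv kk (L ^ r * L ^ kk) hL k p.1) ∘ (liftEquiv (bshiftEquiv (cvM d L mv kk hL) (L ^ r * L ^ kk) μ) ι)) = mulOp ((fun p : CvX' d L mv kk r hL × ι => knitH d L mv kk (L ^ r * L ^ kk) hL k p.1) ∘
      (liftEquiv (bshiftEquiv (cvM d L mv kk hL) (L ^ r * L ^ kk) μ) ι)) := fun k μ => cut_hcube_comp_shift (2 * L) (fun ν (p : CvX' d L mv kk r hL × ι) => coverXi (cvM d L mv kk hL) (L ^ r * L ^ kk) (L ^ mv) ν p.1) 2 (fun μ => liftEquiv (bshiftEquiv (cvM d L mv kk hL) (L ^ r * L ^ kk) μ) ι) μ (by norm_num) (hwin2' μ k)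
  have hhsbf : ∀ k μ, mulOp (fun p : CvX' d L mv kk r hL × ι => cvChi' d L mv kk r hL k p.1) ∘ₗ mulOp ((fun p : CvX' d L mv kk r hL × ι => knitH d L mv kk (L ^ r * L ^ kk) hL k p.1) ∘ (liftEquiv (bshiftEquiv (cvM d L mv kk hL) (L ^ r * L ^ kk) μ) ι).symm) = mulOp ((fun p : CvX' d L mv kk r hL × ι => knitH d L mv kk (L ^ r * L ^ kk) hL k p.1) ∘
      (liftEquiv (bshiftEquiv (cvM d L mv kk hL) (L ^ r * L ^ kk) μ) ι).symm) := fun k μ => cut_hcube_comp_shift_symm (2 * L) (fun ν (p : CvX' d L mv kk r hL × ι) => coverXi (cvM d L mv kk hL) (L ^ r * L ^ kk) (L ^ mv) ν p.1) 2 (fun μ => liftEquiv (bshiftEquiv (cvM d L mv kk hL) (L ^ r * L ^ kk) μ) ι) μ (by norm_num) (hwin2' μ k)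
  have hhddf : ∀ k μ, mulOp (fun p : CvX' d L mv kk r hL × ι => cvChi' d L mv kk r hL k p.1) ∘ₗ mulOp (fgrad η'⁻¹ (liftEquiv (bshiftEquiv (cvM d L mv kk hL) (L ^ r * L ^ kk) μ) ι) (fun p : CvX' d L mv kk r hL × ι => knitH d L mv kk (L ^ r * L ^ kk) hL k p.1)) = mulOp (fgrad η'⁻¹ (liftEquiv (bshiftEquiv (cvM d L mv kk hL) (L ^ r * L ^ kk) μ) ι)
      (fun p : CvX' d L mv kk r hL × ι => knitH d L mv kk (L ^ r * L ^ kk) hL k p.1)) := fun k μ => cut_fgrad_hcube (2 * L) (fun ν (p : CvX' d L mv kk r hL × ι) => coverXi (cvM d L mv kk hL) (L ^ r * L ^ kk) (L ^ mv) ν p.1) 2 (fun μ => liftEquiv (bshiftEquiv (cvM d L mv kk hL) (L ^ r * L ^ kk) μ) ι) μ (by norm_num) η'⁻¹ (hwin2' μ k)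
  have hhddbf : ∀ k μ, mulOp (fun p : CvX' d L mv kk r hL × ι => cvChi' d L mv kk r hL k p.1) ∘ₗ mulOp (bgrad η'⁻¹ (liftEquiv (bshiftEquiv (cvM d L mv kk hL) (L ^ r * L ^ kk) μ) ι) (fun p : CvX' d L mv kk r hL × ι => knitH d L mv kk (L ^ r * L ^ kk) hL k p.1)) = mulOp (bgrad η'⁻¹ (liftEquiv (bshiftEquiv (cvM d L mv kk hL) (L ^ r * L ^ kk) μ) ι)
      (fun p : CvX' d L mv kk r hL × ι => knitH d L mv kk (L ^ r * L ^ kk) hL k p.1)) := fun k μ => cut_bgrad_hcube (2 * L) (fun ν (p : CvX' d L mv kk r hL × ι) => coverXi (cvM d L mv kk hL) (L ^ r * L ^ kk) (L ^ mv) ν p.1) 2 (fun μ => liftEquiv (bshiftEquiv (cvM d L mv kk hL) (L ^ r * L ^ kk) μ) ι) μ (by norm_num) η'⁻¹ (hwin2' μ k)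
  -- 53 at the cover
  have key := uN_hasMaj_idef_glueInv_smoothCutDressed_localGauges (X := CvX d L mv kk hL) (X' := CvX' d L mv kk r hL) (ι := ι) (J := Fin (d + 1)) (K := Fin (d + 1) → ZMod (2 * L))
    (g := unitTorusGeo L kk (cvM d L mv kk hL)) (cvBlk d L mv kk hL) (kingPrV L kk r (cvM d L mv kk hL)) (bshiftEquiv (cvM d L mv kk hL) (L ^ kk)) (bshiftEquiv (cvM d L mv kk hL) (L ^ r * L ^ kk))
    (N := cvCube d L mv kk hL a ι) (N' := cvCube' d L mv kk r hL a ι) (NL := cvNL d L mv kk hL a ι) (NL' := cvNL' d L mv kk r hL a ι)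
    (χX := cvChi d L mv kk hL) (χtX := cvBump d L mv kk hL) (ψX := cvPsi d L mv kk hL) (hX := knitH d L mv kk (L ^ kk) hL)
    (χX' := cvChi' d L mv kk r hL) (χtX' := cvBump' d L mv kk r hL) (ψX' := cvPsi' d L mv kk r hL) (hX' := knitH d L mv kk (L ^ r * L ^ kk) hL)
    (Sk := cvSk d L mv kk hL) (hb := coverHb (cvM d L mv kk hL) (L ^ kk) (L ^ mv) L) (σ := δm / 32) (cr := cr) (β := β) (β₁ := β₁) (ct := π / W) (m₀ := mc * εk) (m₁ := max me mh * εk) (oχ := π * (d + 1) / (((L ^ kk : ℕ) : ℝ) * W)) (oχ₁ := 2 * (π * (d + 1) / (((L ^ kk : ℕ) : ℝ) * W))) (oχ₂ := (W)⁻¹ * (((L ^ kk : ℕ) : ℝ) * W)⁻¹ * (32 * π ^ 4 + π ^ 2 * (d + 1))) (δ := δm) (ρ₁ := δm / 2) (ρ₂ := δm / 4) (ρ₃ := δm / 8) (ρN := δm - δm / 2) (ρT := δm / 2) (δV := δm) (ε := δm / 2) (R := R) (o := o) (c₁ := π / W) (c₂ := 32 * π ^ 2 / W ^ 2) (o₁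 := O1) (o₂ := O2) (rW := 0) (θW := 0) (cN := (π * (d + 1) / W * (Real.exp 1 * (δm / 2))⁻¹ + 2 * (π * (d + 1) / W)) * cN₀) (rN := RNK) (ℓ := π * (d + 1) / W) (ω := π * (d + 1) / W) (d₁ := 1) (oo := π * (d + 1) / (((L ^ kk : ℕ) : ℝ) * W)) (ε₀ := εT) (rF := RFK) (Nov := Nov) (oW := oW) (rV := rV) (RN := RN) (θF := θ₀) (ρF := δm) (rD := rD) (oV := oV) (oN := oN) e η η'
    (htri := triangle254_unitTorusGeo L kk _) (hd := unitTorusGeo_dist_nonneg L kk _) (hd0 := unitTorusGeo_dist_self L kk _) (hsymm := unitTorusGeo_dist_symm L kk _) (hrow := hrow) (hσ := by positivity) (hcr := hcr0) (hβ := hβ0) (hβ₁ := hβ₁0) (hct := div_nonneg pi_pos.le hWpos.le) (hm₀ := mul_nonneg hmc.le hεk0) (hm₁ := mul_nonneg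
    hmax hεk0) (hoχ := hoχ0) (hoχ₁ := mul_nonneg zero_le_two hoχ0) (hoχ₂ := hoχ₂0) (hR := hR0.le) (ho := ho0) (hσρ := by linarith only [hδm0]) (hρ₁V := by linarith only [hδm0]) (hρ₁G := by linarith only [hδm0]) (hρ₂ := by positivity) (hρ₂₁ := by linarith only [hδm0]) (hρ₂T := by linarith only [hδm0]) (hρ₃ := by positivity) (hρ₃₂
    := by linarith only [hδm0]) (hρ₃V := by linarith only [hδm0]) (hρ₃N := by linarith only [hδm0]) (hσρ₃ := by linarith only [hδm0]) (hε := by positivity) (hc₁ := div_nonneg pi_pos.le hWpos.le) (hc₂ := div_nonneg (by positivity) (pow_nonneg hWpos.le 2)) (ho₁ := ho₁0) (ho₂ := ho₂0) (hrW := le_rfl) (hθW := le_rfl) (hcN := hcN0)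
    (hrN := hRNK0) (hℓ := div_nonneg (by positivity) hWpos.le) (hω := div_nonneg (by positivity) hWpos.le) (hd₁ := zero_le_one) (hoo := hoχ0) (hε₀ := hεT0) (hrF := hRFK0) (hNov := hNov0) (hn := by rw [hηinv]; exact hnR0) (hn' := by rw [hη'inv]; exact hn'R0) (hSχ := fun k x hx => Finset.mem_coe.mpr
    (blockOf_mem_cubeBlocks_of_inner_ne_zero hM hm₁ hfitI hS0 hx)) (hSψ := fun k x hx => Finset.mem_coe.mpr (by by_contra h; exact hx (chiCube_of_not_mem h))) (hSχ' := hSχ') (hSψ' := hSψ') (hχt := fun k x => abs_bcube_cover_le_one 2 k x) (hdχt := hdχt) (hdχtb := hdχtb) (hsub := fun k => bcube_cover_lift_cut 2 ι hM hw hlo hhi hS6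
    k) (hχ := fun k => cut_bcube_cover_lift 2 ι hM hw hlo hhi hS6 k) (hs := fun k μ => bcube_cover_lift_comp_shift_cut 2 ι hM hw hlo hhi hS6 k μ) (hsb := fun k μ => bcube_cover_lift_comp_shift_symm_cut 2 ι hM hw hlo hhi hS6 k μ) (hdd := fun k μ => fgrad_bcube_cover_lift_cut 2 ι hM hw hlo hhi hS6 η⁻¹ k μ) (hddb := fun k μ =>
    bgrad_bcube_cover_lift_cut 2 ι hM hw hlo hhi hS6 η⁻¹ k μ) (hNψ := fun k => cube_comp_psi_cover_lift (m₀ := coverMargin L mv) ι hM ha k) (hχt' := fun k x => abs_bcube_cover_le_one 2 k x) (hdχt' := hdχt') (hdχtb' := hdχtb') (hsub' := hsub') (hχ' := hχ') (hs' := hs') (hsb' := hsb') (hdd' := hdd') (hddb' := hddb') (hNψ' := hNψ')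
    (hfitχ := hfitχ) (hfit₁ := hfit₁) (hfit₁b := hfit₁b) (hfit₂ := hfit₂) (hfit₂b := hfit₂b) (hcut := fun k => hasMaj_cut_cover_lift (m₀ := coverMargin L mv) ι hM hm₁ hfitI hS0 hC.le hδ₀.le hδmδ₀ hG k) (hcutF := fun k μ => hasMaj_cutF_cover_lift (m₀ := coverMargin L mv) ι hM hm₁ hfitI hS0 hC hδ₀ hδmδ₀ hηinv μ (hD μ) k) (hcutB :=
    fun k μ => hasMaj_cutB_cover_lift (m₀ := coverMargin L mv) ι hM hm₁ hfitI hS0 hC hδ₀ hδmδ₀ hηinv μ (hD μ) k) (hcut' := hcut') (hcutF' := hcutF') (hcutB' := hcutB') (hDcut := hDcut) (hDcutF := hDcutF) (hDcutB := hDcutB) (hs2 := fun k μ => cut_bcube_cover_lift_comp_shift 2 ι hM hw hlo hhi hS6 k μ) (hsb2 := fun k μ =>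
    cut_bcube_cover_lift_comp_shift_symm 2 ι hM hw hlo hhi hS6 k μ) (hdd2 := fun k μ => cut_fgrad_bcube_cover_lift 2 ι hM hw hlo hhi hS6 η⁻¹ k μ) (hddb2 := fun k μ => cut_bgrad_bcube_cover_lift 2 ι hM hw hlo hhi hS6 η⁻¹ k μ) (hs2' := hs2') (hsb2' := hsb2') (hdd2' := hdd2') (hddb2' := hddb2') (hq := hq₀.trans_lt (by norm_num))
    (hh1 := hh1) (hh1b := hh1b) (hh1' := hh1') (hh1b' := hh1b') (hh2' := hh2') (hf1 := hf1) (hf1b := hf1b) (hf2 := hf2) (hLip := fun k y y' => abs_coverHb_sub_le hM hw k y y') (hrh := fun k p => abs_coverH_sub_coverHb_le hM hw k p.1) (hrh' := hrh') (hfh := hfh) (hstep := hstep) (hstep' := hstep') (hKN' := hKN') (hDKN := hDKN)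
    (hh2 := hh2) (hKN := fun k => hasMaj_commOp_nonlocal_cover_lift (δN := δm) ι hM hw hC₁.le hδm0.le hδmδ₁ (half_pos hδm0) hNL k) (hhabs := fun k x => abs_coverH_le_one k x) (hhabs' := fun k x' => abs_coverH_le_one k x') (hhcut := fun k => hcube_cut (2 * L) (fun ν (p : CvX d L mv kk hL × ι) => coverXi (cvM d L mv kk hL) (L ^
    kk) (L ^ mv) ν p.1) (fun μ => liftEquiv (bshiftEquiv (cvM d L mv kk hL) (L ^ kk) μ) ι) 0 (hwin 0 k)) (hhcut' := hhcut') (hN := fun y => sum_ind_cubeBlocks_le (M := cvM d L mv kk hL) (w := L ^ mv) (q := L) (m₀ := coverMargin L mv) L kk y) (hT := fun k => hasMaj_tail_cover_lift (m₀ := coverMargin L mv) (δN := δm) (ρ₁ := 3 * δm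
    / 4) (ρ := δm / 2) ι hM hM' hw hL2 hfit hS0 htri0 hrow hC.le hδ₀.le hC₁.le hδm0.le hδmδ₁ (by linarith only [hδm0]) (by positivity) (by linarith only [hδmδ₀, hδm0]) (by linarith only [hδm0]) hG hNL k) (hT' := hT') (hDT := hDT) (hfitW := hfitW) (hfitWT := hfitWT) (hoW := hoW0) (he := he) (hu := hu) (hu' := hu') (hrV := hrV)
    (hRN := hRN) (hθF := hθ₀0.le) (hρF := by linarith only [hδm0]) (hrD := hrD) (hoV := hoV) (hoN := hoN) (hRle := hRle) (hole := hole) (hP := hP) (hP' := hP') (hχ1 := fun k x => abs_chiCube_le_one _ x) (hχ1' := fun k x => abs_chiCube_le_one _ x) (hψχ := fun k => mulOp_comp_mulOp_of_support_left fun p hp =>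
    chiCube_eq_one_of_inner_ne_zero hM hm₁ hfitI hS0 hp) (hψχ' := hψχ') (hCloc := hCloc) (hAloc := hAloc) (hCloc' := hCloc') (hAloc' := hAloc') (hfitC := hfitC) (hfitA := hfitA) (hNVcut := hNVcut) (hNVcut' := hNVcut') (hDNV := hDNV) (hfarN := fun k => (hfarN k).mono fun y y' => mul_le_mul_of_nonneg_right hθle (Real.exp_nonneg
    _)) (hfarN' := fun k => (hfarN' k).mono fun y y' => mul_le_mul_of_nonneg_right hθle (Real.exp_nonneg _)) (hDfarN := hDfarN) (hhψ := fun k => mulOp_comp_mulOp_of_support fun p hp => chiCube_coverCorner_eq_one hM hw hfit 0 k p.1 ⟨p.1, Or.inl rfl, abs_cenRep_lt_one_of_hcube_ne_zero (2 * L) (coverXi (cvM d L mv kk hL) (L ^ kk)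
    (L ^ mv)) hp⟩) (hχh := fun k => cut_hcube (2 * L) (fun ν (p : CvX d L mv kk hL × ι) => coverXi (cvM d L mv kk hL) (L ^ kk) (L ^ mv) ν p.1) 2 (fun μ => liftEquiv (bshiftEquiv (cvM d L mv kk hL) (L ^ kk) μ) ι) 0 (by norm_num) (hwin2 0 k)) (hhs' := fun k μ => cut_hcube_comp_shift (2 * L) (fun ν (p : CvX d L mv kk hL × ι) =>
    coverXi (cvM d L mv kk hL) (L ^ kk) (L ^ mv) ν p.1) 2 (fun μ => liftEquiv (bshiftEquiv (cvM d L mv kk hL) (L ^ kk) μ) ι) μ (by norm_num) (hwin2 μ k)) (hhsb' := fun k μ => cut_hcube_comp_shift_symm (2 * L) (fun ν (p : CvX d L mv kk hL × ι) => coverXi (cvM d L mv kk hL) (L ^ kk) (L ^ mv) ν p.1) 2 (fun μ => liftEquiv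
    (bshiftEquiv (cvM d L mv kk hL) (L ^ kk) μ) ι) μ (by norm_num) (hwin2 μ k)) (hhdd' := fun k μ => cut_fgrad_hcube (2 * L) (fun ν (p : CvX d L mv kk hL × ι) => coverXi (cvM d L mv kk hL) (L ^ kk) (L ^ mv) ν p.1) 2 (fun μ => liftEquiv (bshiftEquiv (cvM d L mv kk hL) (L ^ kk) μ) ι) μ (by norm_num) η⁻¹ (hwin2 μ k)) (hhddb' := fun
    k μ => cut_bgrad_hcube (2 * L) (fun ν (p : CvX d L mv kk hL × ι) => coverXi (cvM d L mv kk hL) (L ^ kk) (L ^ mv) ν p.1) 2 (fun μ => liftEquiv (bshiftEquiv (cvM d L mv kk hL) (L ^ kk) μ) ι) μ (by norm_num) η⁻¹ (hwin2 μ k)) (hhψf := hhψf) (hχhf := hχhf) (hhsf := hhsf) (hhsbf := hhsbf) (hhddf := hhddf) (hhddbf := hhddbf) (hq'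
    := hsmall.1)
  have hsm := cvSmall53 (Nov := Nov) (cι2 := cι2) (cι := (Fintype.card ι : ℝ)) (cJ := (Fintype.card (Fin (d + 1)) : ℝ)) (β := β) (β₁ := β₁) (ct := π / W) (R := R) (cr := cr) (c₁ := π / W) (c₂ := 32 * π ^ 2 / W ^ 2) (θW := 0) (cN := (π * (d + 1) / W * (Real.exp 1 * (δm / 2))⁻¹ + 2 * (π * (d + 1) / W)) * cN₀) (ℓ := π * (d + 1) / W) (ε := δm / 2) (ω := π
    * (d + 1) / W) (d₁ := 1) (θF := θ₀) (ε₀ := εT) (m₀ := mc * εk) (m₁ := max me mh * εk) (oχ := π * (d + 1) / (((L ^ kk : ℕ) : ℝ) * W)) (oχ₁ := 2 * (π * (d + 1) / (((L ^ kk : ℕ) : ℝ) * W))) (oχ₂ := (W)⁻¹ * (((L ^ kk : ℕ) : ℝ) * W)⁻¹ * (32 * π ^ 4 + π ^ 2 * (d + 1))) (o := o) (o₁ := O1) (o₂ := O2) (rW := 0) (rN := RNK) (oo := π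
    * (d + 1) / (((L ^ kk : ℕ) : ℝ) * W)) (rF := RFK) (rD := rD) (oW := oW) (η := η) (η' := η') (S := Sdef) (ctb := π) (c₁b := π) (c₂b := 32 * π ^ 2) (cNb := (π * (d + 1) * E' + 2 * (π * (d + 1))) * cN₀) (ε₀b := κT) (θFb := θ₀) (LRb := π * (d + 1) * E' + 2 * (π * (d + 1) + π * (d + 1) * 1)) (km₀ := mc) (km₁ := max me mh) (koχ :=
    π * (d + 1)) (koχ₁ := 2 * (π * (d + 1))) (koχ₂ := 32 * π ^ 4 + π ^ 2 * (d + 1)) (ko := 1) (ko₁ := 64 * π ^ 2 + π ^ 2 * Fintype.card (Fin (d + 1))) (ko₂ := 144 * π ^ 3 + 32 * π ^ 3 * Fintype.card (Fin (d + 1))) (krW := 0) (krN := KRN) (koo := π * (d + 1)) (krF := KRF) (krD := 1) (koW := 1) (kη0 := π) (kη1 := π) hNov0 hcι20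
    (Nat.cast_nonneg _) (Nat.cast_nonneg _) hβ0 hβ₁0 hR0.le hcr0 le_rfl (div_nonneg pi_pos.le hWpos.le) (div_le_self pi_pos.le hW1) (div_nonneg pi_pos.le hWpos.le) (div_le_self pi_pos.le hW1) (div_nonneg (by positivity) (pow_nonneg hWpos.le 2)) (div_le_self (by positivity) (by nlinarith only [hW1])) hcN0
    (mul_le_mul_of_nonneg_right hLRb hcN₀0) hεT0 hεTκ hθ₀0.le le_rfl (cv_inv_le_two hq₀).1 (cv_inv_le_two hq₀).2 (cv_inv_le_two' hq₀).1 (cv_inv_le_two' hq₀).2 hLR20 hLRb2 hhalf.1 hhalf.2 (mul_nonneg hmc.le hεk0) (mul_le_mul_of_nonneg_left hεS hmc.le) (mul_nonneg hmax hεk0) (mul_le_mul_of_nonneg_left hεS hmax) hoχ0 hsoχ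
    (mul_nonneg zero_le_two hoχ0) hsoχ₁ hoχ₂0 hsoχ₂ ho0 hso ho₁0 hso₁ ho₂0 hso₂ le_rfl (by rw [zero_mul]) hRNK0 hsRN hoχ0 hsoχ hRFK0 hsRF hrD hsrD hoW0 hsoW (div_nonneg (div_nonneg pi_pos.le hWpos.le) (inv_nonneg.mpr hη0)) hsDη0 (div_nonneg (div_nonneg pi_pos.le hWpos.le) (inv_nonneg.mpr hη'0)) hsDη1
  refine key.mono fun y y' => ?_
  exact mul_le_mul hsm.2 (Real.exp_le_exp.mpr (le_of_eq (by ring))) (Real.exp_nonneg _) (hsm.1.trans hsm.2)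

end Knit

end Summit.QuantumFields.YangMills.BalabanUVNodes.N15.Gluing

end
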